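import Literature.NumberTheory.EllipticCurves.ThreeTorsionFakePointAssemblyUnitProofs
import Literature.NumberTheory.GaloisRepresentations.CubicEisensteinRamificationProofs
import Literature.NumberTheory.GaloisRepresentations.RatPlaceTwoProofs
import HarnessLib

/-!
# The Galois side of Ogg's formula at `2` for cyclic wild inertia (`C₄`): `Sw_𝔓(E[3]) = 6`

`Proofs` file (theorems only, no definitions, no named facts) in topic
`NumberTheory/EllipticCurves`, landed by the seat of bsd.S15
(`Literature.NumberTheory.EllipticCurves.conductorNorm_eq_artinConductorNat_of_isElliptic`),
companion of the fake-point files (`ThreeTorsionFakePointSwanProofs`, …, quaternion wild inertia)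
for the remaining potentially good, non-twist classes at `2`: the curves whose inertia group acts on
`E[3]` through a **cyclic group of order `4`** (Kodaira types `III` with `(v(Δ), v(c₄), v(c₆)) =
(9, 5, 8)` and `III*` with `(15, 7, 11)` over `ℚ`; `j = 1728 (1 - 2u)⁻¹`).  There the `x`-coordinate
field `E = K(x(E[3])) = K(ζ, δ, R₀, R₁, R₂)` (`δ³ = Δ`, `R_k² = A_k = c₄ - 12ζ^kδ`,
`R₀R₁R₂ = c₆`) has inertia of order **`2`** at `𝔓 ∣ 2`: `3 ∣ v(Δ)` makes `δ/2^q` a unit, so inertia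
fixes `ζ` and `δ` and acts by even sign changes on `(R₀, R₁, R₂)`; and `A₀` is `𝔓`-adically close
to the square of a Galois-fixed element `γ` (`v(A₀ - γ²) > 2 v(2γ)`), which forbids `R₀ ↦ -R₀` in
the decomposition group (`(R₀ - γ)(R₀ + γ) = A₀ - γ²` would have two factors of equal order
`≥ v(2γ) + 1`, of difference `2γ`).  With `A₁ = 2^a u₁`, `A₂ = 2^a u₂` (`a` odd, units `u_k`) the
order `v_{𝔓_E}(2) = #Q₀` is even, so `#Q₀ = 2`, `Q₀ = Q₁ = {1, τ}`, `τR₁ = -R₁`,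
`i(τ) = v(2R₁) - v(R₁) + 1 = 3`, `φ_E(4) = (2 + 2 + 1 + 1)/2 = 3`; above, `K(E[3]) = E(Y₁)` with
`Y₁² = X₁³ - 27c₄X₁ - 54c₆ = 54(R₀ + R₁)(R₁ + R₂)(R₂ + R₀)` of odd order `2 + 3a`
(`v(R₀) > v(R₁) = v(R₂) = a = v(R₁ ± R₂)`), so the central involution has break
`b = v_{𝔓_L}(2) = 4` and **`Sw_𝔓(E[3]) = 2 φ_E(4) = 6`**
(`swanConductorAt_torsion_three_eq_two_mul_herbrandPhi_xDivisionField`), the value `f - 2 = 8 - 2`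
of Ogg's formula for these types (Silverman *ATAEC* IV.11.1; Papadopoulos' table at `p = 2`).

* `WeierstrassCurve.swanConductorAt_torsion_three_eq_six_of_cyclic_cert` — the statement above,
  from the certificate data `(a, q, u₀ ∈ 𝔓_E, u₁, u₂ ∉ 𝔓_E, γ)`, over any number field `K` with
  `2 ∈ v ∖ v²`;
* `WeierstrassCurve.swanConductorAt_torsion_three_of_cyclic_class` — **the classes over `ℚ`**:
  `c₄ = 2^{5+2j} c₄'`, `c₆ = 2^{8+3j} c₆'`, `Δ = 2^{9+6j} Δ'` with `c₄', c₆'` odd (`j = 0, 1`: the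
  minimal models of Kodaira types `III`, `III*` with `(v(Δ), v(c₄), v(c₆)) = (9, 5, 8), (15, 7, 11)`):
  `Sw_𝔓(E[3]) = 6` for every `𝔓 ∣ 2`; the certificate is `q = 3 + 2j`, `a = 5 + 2j`,
  `u_k = c₄' - 3ζ^kδ₁`, `γ = 2^{3+j} c₆' ρ` with `ρ = 1` or `1 + 2ζ` according to `c₄' mod 4`, read off
  `27 δ₁³ = c₄'³ - 2 c₆'²` (`u₀ (9δ₁² + 3c₄'δ₁ + c₄'²) = 2c₆'²`) and `δ₁ ≡ Δ' (mod 8)`.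

## References

* J.-P. Serre, *Local Fields*, GTM 67 (1979), Ch. I §7 Prop. 20–22, Ch. IV §1 Prop. 2–3, §2
  Prop. 5 and Cor. 1–3 of Prop. 7, §3 Lemma 3. [SerreLocalFields1979]
* J. H. Silverman, *Advanced Topics in the Arithmetic of Elliptic Curves*, GTM 151 (1994), §IV.10
  (PDF p. 358), Thm. IV.11.1 (`p = 2`, p. 366). [SilvermanATAEC1994]

## Design

No definitions.  `K` a number field with `2 ∈ v ∖ v²` (so that `v_{𝔓_E}(2) = #Q₀`);
`noncomputable section`; namespace `WeierstrassCurve`; local instances as in the sibling files.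
Axioms: `propext`, `Classical.choice`, `Quot.sound`.
-/

noncomputable section

open scoped Classical NumberField Pointwise
open Field IsDedekindDomain Polynomial

attribute [local instance] AddSubgroup.torsionBy.zmodModule
attribute [local instance 1001] IntermediateField.algebra'
attribute [local instance 1002] AlgebraicClosure.instAlgebra

namespace WeierstrassCurve

open Literature.NumberTheory.EllipticCurves Literature.NumberTheory.GaloisRepresentations

variable {K : Type} [Field K] [NumberField K] (W : WeierstrassCurve K)

set_option maxHeartbeats 3200000 in
set_option synthInstance.maxHeartbeats 400000 in
/-- **`Sw_𝔓(E[3]) = 6` for cyclic wild inertia of order `4`.**  `K` a number field, `v ∣ 2` with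
`2 ∉ v²`, `3 ∉ v`, `𝔓 ∣ v` a prime of `\bar ℤ_K`; radicals `ζ, δ, R₀, R₁, R₂` of `E[3]`
(`ζ² + ζ + 1 = 0`, `δ³ = Δ`, `R_k² = c₄ - 12ζ^kδ`, `R₀R₁R₂ = c₆ ≠ 0`) with integral copies
`ζ_E, R_{kE}, δ₁ ∈ S_E` (`E = K(x(E[3]))`, `δ₁ 2^q = δ`, `δ₁ ∉ 𝔓_E`); the certificate:
`R₀² = 2^a u₀` with `u₀ ∈ 𝔓_E`, `R₁² = 2^a u₁`, `R₂² = 2^a u₂` with `u₁, u₂ ∉ 𝔓_E`, `a = q + 2`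
odd, and `γ ∈ S_E`, fixed by every `σ ∈ Γ_K` fixing `ζ` and `δ`, with
`v_{𝔓_E}(2 (2γ)²) ≤ v_{𝔓_E}(R₀² - γ²)`.  Then `Sw_𝔓(E[3]) = 6`.
[cite: SilvermanATAEC1994, §IV.10 Definition of δ (PDF p. 358), Thm. IV.11.1 p = 2 (p. 366)]
[cite: SerreLocalFields1979, Ch. IV §1 Prop. 2–3, §2 Prop. 5, §3 Lemma 3] -/
theorem swanConductorAt_torsion_three_eq_six_of_cyclic_cert [W.IsElliptic]
    {v : HeightOneSpectrum (𝓞 K)} (hv2 : (2 : 𝓞 K) ∈ v.asIdeal) (hv4 : (2 : 𝓞 K) ∉ v.asIdeal ^ 2)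
    (h3 : ((3 : ℕ) : 𝓞 K) ∉ v.asIdeal)
    {𝔓 : Ideal (absIntegers (𝓞 K) K)} (h𝔓 : 𝔓 ∈ v.primesAbove)
    {ζ δ R₀ R₁ R₂ : AlgebraicClosure K} (hζ : ζ ^ 2 + ζ + 1 = 0)
    (hδ : δ ^ 3 = algebraMap K (AlgebraicClosure K) W.Δ)
    (h₀ : R₀ ^ 2 = algebraMap K (AlgebraicClosure K) W.c₄ - 12 * δ)
    (h₁ : R₁ ^ 2 = algebraMap K (AlgebraicClosure K) W.c₄ - 12 * ζ * δ)
    (h₂ : R₂ ^ 2 = algebraMap K (AlgebraicClosure K) W.c₄ - 12 * ζ ^ 2 * δ)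
    (hρ : R₀ * R₁ * R₂ = algebraMap K (AlgebraicClosure K) W.c₆) (hc₆ : W.c₆ ≠ 0)
    {ζE R₀E R₁E R₂E δ₁ u₀ u₁ u₂ γ : integralClosure (𝓞 K) (W.xDivisionField 3)}
    (vζ : ((ζE : W.xDivisionField 3) : AlgebraicClosure K) = ζ)
    (vR₀ : ((R₀E : W.xDivisionField 3) : AlgebraicClosure K) = R₀)
    (vR₁ : ((R₁E : W.xDivisionField 3) : AlgebraicClosure K) = R₁)
    (vR₂ : ((R₂E : W.xDivisionField 3) : AlgebraicClosure K) = R₂)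
    {q : ℕ} (vδ₁ : ((δ₁ : W.xDivisionField 3) : AlgebraicClosure K) * 2 ^ q = δ)
    (hδ₁u : δ₁ ∉ 𝔓.comap ((W.xDivisionField 3).integralClosureToAbsIntegers (𝓞 K)))
    {a : ℕ} (ha : Odd a) (haq : a = q + 2)
    (hR₀sq : R₀E ^ 2 = 2 ^ a * u₀) (hu₀ : u₀ ∈ 𝔓.comap ((W.xDivisionField 3).integralClosureToAbsIntegers (𝓞 K)))
    (hR₁sq : R₁E ^ 2 = 2 ^ a * u₁) (hu₁ : u₁ ∉ 𝔓.comap ((W.xDivisionField 3).integralClosureToAbsIntegers (𝓞 K)))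
    (hR₂sq : R₂E ^ 2 = 2 ^ a * u₂) (hu₂ : u₂ ∉ 𝔓.comap ((W.xDivisionField 3).integralClosureToAbsIntegers (𝓞 K)))
    (hγfix : ∀ σ : absoluteGaloisGroup K, σ • ζ = ζ → σ • δ = δ →
      σ • ((γ : W.xDivisionField 3) : AlgebraicClosure K) = ((γ : W.xDivisionField 3) : AlgebraicClosure K))
    (hγ : ord (𝔓.comap ((W.xDivisionField 3).integralClosureToAbsIntegers (𝓞 K))) (2 * (2 * γ) ^ 2) ≤
      ord (𝔓.comap ((W.xDivisionField 3).integralClosureToAbsIntegers (𝓞 K))) (R₀E ^ 2 - γ ^ 2)) :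
    (W.torsionGaloisRep 3).swanConductorAt (𝓞 K) 𝔓 = 6 := by
  classical
  haveI : Fact (Nat.Prime 3) := ⟨Nat.prime_three⟩
  have h2K : (2 : K) ≠ 0 := two_ne_zero
  have h3K : (3 : K) ≠ 0 := three_ne_zero
  have h2 : (2 : AlgebraicClosure K) ≠ 0 := two_ne_zero
  have h3' : (3 : AlgebraicClosure K) ≠ 0 := three_ne_zero
  haveI hDDE : IsDedekindDomain (integralClosure (𝓞 K) (W.xDivisionField 3)) :=
    integralClosure.isDedekindDomain (𝓞 K) K (W.xDivisionField 3)
  haveI hDDF : IsDedekindDomain (integralClosure (𝓞 K) (W.divisionField 3)) :=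
    integralClosure.isDedekindDomain (𝓞 K) K (W.divisionField 3)
  haveI : 𝔓.IsPrime := h𝔓.1
  haveI h𝔓max : 𝔓.IsMaximal := HeightOneSpectrum.isMaximal_of_mem_primesAbove h𝔓
  haveI : IsGalois K (W.xDivisionField 3) := {}
  haveI : IsGalois K (W.divisionField 3) := {}
  haveI hPEmax : (𝔓.comap ((W.xDivisionField 3).integralClosureToAbsIntegers (𝓞 K))).IsMaximal :=
    isMaximal_comap_integralClosureToAbsIntegers (𝓞 K) 𝔓 (W.xDivisionField 3)
  haveI hPFmax : (𝔓.comap ((W.divisionField 3).integralClosureToAbsIntegers (𝓞 K))).IsMaximal :=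
    isMaximal_comap_integralClosureToAbsIntegers (𝓞 K) 𝔓 (W.divisionField 3)
  have hunderE : (𝔓.comap ((W.xDivisionField 3).integralClosureToAbsIntegers (𝓞 K))).under (𝓞 K) = v.asIdeal := by
    rw [under_comap_integralClosureToAbsIntegers, ← h𝔓.2.over]
  have hunderF : (𝔓.comap ((W.divisionField 3).integralClosureToAbsIntegers (𝓞 K))).under (𝓞 K) = v.asIdeal := by
    rw [under_comap_integralClosureToAbsIntegers, ← h𝔓.2.over]
  have h2E : (2 : integralClosure (𝓞 K) (W.xDivisionField 3)) ∈
      𝔓.comap ((W.xDivisionField 3).integralClosureToAbsIntegers (𝓞 K)) := by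
    have : (2 : 𝓞 K) ∈ (𝔓.comap ((W.xDivisionField 3).integralClosureToAbsIntegers (𝓞 K))).under (𝓞 K) := by
      rw [hunderE]; exact hv2
    rw [Ideal.under_def, Ideal.mem_comap, map_ofNat] at this
    exact this
  have hPE0 : (𝔓.comap ((W.xDivisionField 3).integralClosureToAbsIntegers (𝓞 K))) ≠ ⊥ := by
    intro h0; rw [h0] at h2E
    exact two_ne_zero ((Ideal.mem_bot).mp h2E)
  have hPF0 : (𝔓.comap ((W.divisionField 3).integralClosureToAbsIntegers (𝓞 K))) ≠ ⊥ := by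
    intro h0
    have hinj : Function.Injective (algebraMap (𝓞 K) (integralClosure (𝓞 K) (W.divisionField 3))) :=
      (faithfulSMul_iff_algebraMap_injective _ _).mp
        (faithfulSMul_integralClosure (𝓞 K) (K := K) (L := (W.divisionField 3)))
    have h2' : (2 : 𝓞 K) ∈ (𝔓.comap ((W.divisionField 3).integralClosureToAbsIntegers (𝓞 K))).under (𝓞 K) := by
      rw [hunderF]; exact hv2
    rw [Ideal.under_def, Ideal.mem_comap, h0, Ideal.mem_bot] at h2'
    exact two_ne_zero (hinj (h2'.trans (map_zero _).symm))
  have h3E : (3 : integralClosure (𝓞 K) (W.xDivisionField 3)) ∉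
      𝔓.comap ((W.xDivisionField 3).integralClosureToAbsIntegers (𝓞 K)) := by
    intro hmem
    apply h3
    rw [← hunderE, Ideal.under_def, Ideal.mem_comap, map_natCast]
    exact_mod_cast hmem
  haveI hfinqE : Finite (integralClosure (𝓞 K) (W.xDivisionField 3) ⧸
      (𝔓.comap ((W.xDivisionField 3).integralClosureToAbsIntegers (𝓞 K)))) := by
    have hmodfin : Module.Finite (𝓞 K) (integralClosure (𝓞 K) (W.xDivisionField 3)) :=
      IsIntegralClosure.finite (𝓞 K) K (W.xDivisionField 3) (integralClosure (𝓞 K) (W.xDivisionField 3))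
    haveI hlies : (𝔓.comap ((W.xDivisionField 3).integralClosureToAbsIntegers (𝓞 K))).LiesOver (𝔓.under (𝓞 K)) :=
      ⟨(under_comap_integralClosureToAbsIntegers (𝓞 K) 𝔓 (W.xDivisionField 3)).symm⟩
    haveI : Finite ((𝓞 K) ⧸ 𝔓.under (𝓞 K)) := by
      rw [← h𝔓.2.over]; exact Ideal.finiteQuotientOfFreeOfNeBot v.asIdeal v.ne_bot
    haveI : Module.Finite ((𝓞 K) ⧸ 𝔓.under (𝓞 K)) (integralClosure (𝓞 K) (W.xDivisionField 3) ⧸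
        (𝔓.comap ((W.xDivisionField 3).integralClosureToAbsIntegers (𝓞 K)))) :=
      @module_finite_of_liesOver (𝓞 K) (integralClosure (𝓞 K) (W.xDivisionField 3)) _ _ _
        (𝔓.comap ((W.xDivisionField 3).integralClosureToAbsIntegers (𝓞 K))) (𝔓.under (𝓞 K)) hlies hmodfin
    exact Module.finite_of_finite ((𝓞 K) ⧸ 𝔓.under (𝓞 K))
  haveI hfinqF : Finite (integralClosure (𝓞 K) (W.divisionField 3) ⧸
      (𝔓.comap ((W.divisionField 3).integralClosureToAbsIntegers (𝓞 K)))) := by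
    have hmodfin : Module.Finite (𝓞 K) (integralClosure (𝓞 K) (W.divisionField 3)) :=
      IsIntegralClosure.finite (𝓞 K) K (W.divisionField 3) (integralClosure (𝓞 K) (W.divisionField 3))
    haveI hlies : (𝔓.comap ((W.divisionField 3).integralClosureToAbsIntegers (𝓞 K))).LiesOver (𝔓.under (𝓞 K)) :=
      ⟨(under_comap_integralClosureToAbsIntegers (𝓞 K) 𝔓 (W.divisionField 3)).symm⟩
    haveI : Finite ((𝓞 K) ⧸ 𝔓.under (𝓞 K)) := by
      rw [← h𝔓.2.over]; exact Ideal.finiteQuotientOfFreeOfNeBot v.asIdeal v.ne_bot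
    haveI : Module.Finite ((𝓞 K) ⧸ 𝔓.under (𝓞 K)) (integralClosure (𝓞 K) (W.divisionField 3) ⧸
        (𝔓.comap ((W.divisionField 3).integralClosureToAbsIntegers (𝓞 K)))) :=
      @module_finite_of_liesOver (𝓞 K) (integralClosure (𝓞 K) (W.divisionField 3)) _ _ _
        (𝔓.comap ((W.divisionField 3).integralClosureToAbsIntegers (𝓞 K))) (𝔓.under (𝓞 K)) hlies hmodfin
    exact Module.finite_of_finite ((𝓞 K) ⧸ 𝔓.under (𝓞 K))
  -- values and restriction
  have hinjE : ∀ {X Y : integralClosure (𝓞 K) (W.xDivisionField 3)},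
      ((X : W.xDivisionField 3) : AlgebraicClosure K) = ((Y : W.xDivisionField 3) : AlgebraicClosure K) →
        X = Y := fun h => Subtype.ext (Subtype.ext h)
  have hS2 : ((((2 : integralClosure (𝓞 K) (W.xDivisionField 3))) : W.xDivisionField 3) : AlgebraicClosure K) = 2 := rfl
  have hS3 : ((((3 : integralClosure (𝓞 K) (W.xDivisionField 3))) : W.xDivisionField 3) : AlgebraicClosure K) = 3 := rfl
  have hS54 : ((((54 : integralClosure (𝓞 K) (W.xDivisionField 3))) : W.xDivisionField 3) : AlgebraicClosure K) = 54 := rfl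
  have hres : ∀ (g : W.xDivisionField 3 ≃ₐ[K] W.xDivisionField 3) (σ : absoluteGaloisGroup K),
      absRestrictNormalHom (W.xDivisionField 3) σ = g →
      ∀ X : integralClosure (𝓞 K) (W.xDivisionField 3),
        (((g • X : integralClosure (𝓞 K) (W.xDivisionField 3)) : W.xDivisionField 3) : AlgebraicClosure K) =
          σ • ((X : W.xDivisionField 3) : AlgebraicClosure K) := by
    intro g σ hσ X
    rw [integralClosure.coe_smul, ← hσ]
    exact AlgEquiv.restrictNormal_commutes (absoluteGaloisGroup.toAlgEquiv K σ) (W.xDivisionField 3) X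
  have hnumσ : ∀ (σ : absoluteGaloisGroup K) (m : ℕ), σ • ((m : AlgebraicClosure K)) = m := fun σ m ↦ by
    rw [show ((m : AlgebraicClosure K)) = algebraMap K (AlgebraicClosure K) m from (map_natCast _ m).symm]
    exact smul_algebraMap σ (m : K)
  obtain ⟨mR₀, mR₁, mR₂⟩ := W.radical_mem_xDivisionField_three h2K h3K hζ hδ h₀ h₁ h₂ hρ
  have hδ0 : δ ≠ 0 := by
    intro h0
    rw [h0, zero_pow three_ne_zero] at hδ
    exact W.isUnit_Δ.ne_zero ((_root_.map_eq_zero_iff _ (algebraMap K (AlgebraicClosure K)).injective).mp hδ.symm)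
  have hRne : R₀ ≠ 0 ∧ R₁ ≠ 0 ∧ R₂ ≠ 0 := by
    have hprod : R₀ * R₁ * R₂ ≠ 0 := by rw [hρ]; exact (_root_.map_ne_zero _).mpr hc₆
    exact ⟨fun h => hprod (by rw [h]; ring), fun h => hprod (by rw [h]; ring), fun h => hprod (by rw [h]; ring)⟩
  have hζE : ζE ^ 2 + ζE + 1 = 0 := hinjE (by push_cast; rw [vζ]; exact hζ)
  obtain ⟨hζunit, -⟩ := W.zeta_notMem_and_one_add_two_mul_zeta_notMem h3 h𝔓 hζE
  have hζm1 : ζE - 1 ∉ 𝔓.comap ((W.xDivisionField 3).integralClosureToAbsIntegers (𝓞 K)) := by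
    intro h
    have hsq : (ζE - 1) * (ζE - 1) = -(3 * ζE) := by linear_combination hζE
    have h3ζ : 3 * ζE ∈ 𝔓.comap ((W.xDivisionField 3).integralClosureToAbsIntegers (𝓞 K)) := by
      have := Ideal.mul_mem_left _ (ζE - 1) h
      rw [hsq] at this
      exact (neg_mem_iff).mp this
    rcases (Ideal.IsPrime.mem_or_mem inferInstance h3ζ) with h' | h'
    · exact h3E h'
    · exact hζunit h'
  have hζp1 : ζE + 1 ∉ 𝔓.comap ((W.xDivisionField 3).integralClosureToAbsIntegers (𝓞 K)) := by
    intro h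
    have hsq : (ζE + 1) * (ζE + 1) = ζE := by linear_combination hζE
    have := Ideal.mul_mem_left _ (ζE + 1) h
    rw [hsq] at this
    exact hζunit this
  -- `R₀E, R₁E, R₂E ≠ 0`
  have hR₀E0 : R₀E ≠ 0 := fun h => hRne.1 (by rw [← vR₀, h]; rfl)
  have hR₁E0 : R₁E ≠ 0 := fun h => hRne.2.1 (by rw [← vR₁, h]; rfl)
  have hR₂E0 : R₂E ≠ 0 := fun h => hRne.2.2 (by rw [← vR₂, h]; rfl)
  -- ### Step 1: the order `o = v_{𝔓_E}(2) = #Q₀` and `v(R₁) = v(R₂)`, `2 v(R₁) = a o`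
  have hord2 : ord (𝔓.comap ((W.xDivisionField 3).integralClosureToAbsIntegers (𝓞 K)))
      (2 : integralClosure (𝓞 K) (W.xDivisionField 3)) =
      Nat.card ((𝔓.comap ((W.xDivisionField 3).integralClosureToAbsIntegers (𝓞 K))).ramificationSubgroup
        (W.xDivisionField 3 ≃ₐ[K] W.xDivisionField 3) 0) := by
    have h := ord_algebraMap_eq_card_inertia_of_mem_primesAbove h𝔓 (W.xDivisionField 3) (π := 2) hv2 hv4
    rw [map_ofNat] at h
    exact h
  set o : ℕ := Nat.card ((𝔓.comap ((W.xDivisionField 3).integralClosureToAbsIntegers (𝓞 K))).ramificationSubgroup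
        (W.xDivisionField 3 ≃ₐ[K] W.xDivisionField 3) 0) with ho
  have hopos : 0 < o := Nat.card_pos
  obtain ⟨r₁, hr₁⟩ := exists_ord_eq_natCast _ hPE0 hR₁E0
  obtain ⟨r₂, hr₂⟩ := exists_ord_eq_natCast _ hPE0 hR₂E0
  obtain ⟨r₀, hr₀⟩ := exists_ord_eq_natCast _ hPE0 hR₀E0
  have hord2a : ord (𝔓.comap ((W.xDivisionField 3).integralClosureToAbsIntegers (𝓞 K)))
      ((2 : integralClosure (𝓞 K) (W.xDivisionField 3)) ^ a) = ((a * o : ℕ) : ℕ∞) := by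
    rw [ord_pow _ hPE0, hord2]; push_cast; ring
  have h2r₁ : 2 * r₁ = a * o := by
    have h := ord_mul _ hPE0 R₁E R₁E
    rw [← sq, hR₁sq, ord_mul _ hPE0, hord2a, (ord_eq_zero_iff _).mpr hu₁, add_zero, hr₁] at h
    have h' : ((a * o : ℕ) : ℕ∞) = ((r₁ + r₁ : ℕ) : ℕ∞) := by rw [h]; push_cast; rfl
    have := (Nat.cast_injective (R := ℕ∞)) h'
    omega
  have h2r₂ : 2 * r₂ = a * o := by
    have h := ord_mul _ hPE0 R₂E R₂E
    rw [← sq, hR₂sq, ord_mul _ hPE0, hord2a, (ord_eq_zero_iff _).mpr hu₂, add_zero, hr₂] at h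
    have h' : ((a * o : ℕ) : ℕ∞) = ((r₂ + r₂ : ℕ) : ℕ∞) := by rw [h]; push_cast; rfl
    have := (Nat.cast_injective (R := ℕ∞)) h'
    omega
  have hr₀gt : r₁ < r₀ := by
    -- `2 v(R₀) = a o + v(u₀) ≥ a o + 1 > 2 v(R₁)`
    have hu₀1 : (1 : ℕ∞) ≤ ord (𝔓.comap ((W.xDivisionField 3).integralClosureToAbsIntegers (𝓞 K))) u₀ := by
      rw [show (1 : ℕ∞) = ((1 : ℕ) : ℕ∞) from rfl, ← mem_pow_iff_le_ord, pow_one]; exact hu₀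
    have h := ord_mul _ hPE0 R₀E R₀E
    rw [← sq, hR₀sq, ord_mul _ hPE0, hord2a, hr₀] at h
    -- `h : a*o + ord u₀ = r₀ + r₀`
    have hfin : ord (𝔓.comap ((W.xDivisionField 3).integralClosureToAbsIntegers (𝓞 K))) u₀ ≠ ⊤ := by
      intro ht; rw [ht, add_top] at h
      exact ENat.coe_ne_top (r₀ + r₀) (by push_cast; exact h.symm)
    obtain ⟨k, hk⟩ := ENat.ne_top_iff_exists.mp hfin
    rw [← hk] at h hu₀1
    have h' : ((a * o + k : ℕ) : ℕ∞) = ((r₀ + r₀ : ℕ) : ℕ∞) := by push_cast; exact h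
    have e1 := (Nat.cast_injective (R := ℕ∞)) h'
    have hk1 : 1 ≤ k := by exact_mod_cast hu₀1
    omega
  have hoeven : Even o := by
    rcases Nat.even_or_odd o with he | hodd
    · exact he
    · exfalso
      have : Odd (a * o) := ha.mul hodd
      rw [← h2r₁] at this
      exact (Nat.not_odd_iff_even.mpr (even_two_mul r₁)) this
  
  -- ### Step 2: every `g ∈ Q₀` (lift `σ`) fixes `ζ`, `δ` and `R₀`
  obtain ⟨d, hdq⟩ : ∃ d : 𝓞 K, d = (2 : 𝓞 K) ^ q := ⟨_, rfl⟩
  have hd : d ≠ 0 := by rw [hdq]; exact pow_ne_zero _ two_ne_zero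
  have hδ₁' : ((δ₁ : W.xDivisionField 3) : AlgebraicClosure K) *
      algebraMap K (AlgebraicClosure K) (algebraMap (𝓞 K) K d) = δ := by
    rw [hdq, map_pow, map_pow, map_ofNat, map_ofNat]; exact vδ₁
  have hd' : algebraMap (𝓞 K) (integralClosure (𝓞 K) (W.xDivisionField 3)) d ≠ 0 := by
    intro h0
    exact hd ((faithfulSMul_iff_algebraMap_injective _ _).mp
      (faithfulSMul_integralClosure (𝓞 K) (K := K) (L := (W.xDivisionField 3))) (h0.trans (map_zero _).symm))
  have hfix0 : ∀ g, g ∈ (𝔓.comap ((W.xDivisionField 3).integralClosureToAbsIntegers (𝓞 K))).ramificationSubgroup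
      (W.xDivisionField 3 ≃ₐ[K] W.xDivisionField 3) 0 → ∀ σ : absoluteGaloisGroup K,
      absRestrictNormalHom (W.xDivisionField 3) σ = g → σ • ζ = ζ ∧ σ • δ = δ := by
    intro g hg σ hσ
    have hσζ := W.smul_zeta_eq_of_mem_inertia_xDivisionField_three h3 h𝔓 hζ hδ h₀ h₁ h₂ hρ hg σ hσ
    refine ⟨hσζ, ?_⟩
    have hcube : (σ • δ) ^ 3 = δ ^ 3 := by rw [← smul_pow', hδ, smul_algebraMap]
    have hfac : (σ • δ - δ) * (σ • δ - ζ * δ) * (σ • δ - ζ ^ 2 * δ) = 0 := by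
      linear_combination hcube + (-(δ * (σ • δ) ^ 2) + ζ * δ ^ 2 * (σ • δ) - (ζ - 1) * δ ^ 3) * hζ
    have hmem := (Ideal.mem_ramificationSubgroup_iff.mp hg).2 δ₁
    rw [zero_add, pow_one] at hmem
    have hgδ₁val : (((g • δ₁ : integralClosure (𝓞 K) (W.xDivisionField 3)) : W.xDivisionField 3) : AlgebraicClosure K) *
        algebraMap K (AlgebraicClosure K) (algebraMap (𝓞 K) K d) = σ • δ := by
      rw [hres g σ hσ, ← hδ₁', smul_mul', smul_algebraMap]
    have key : ∀ i : ℕ, σ • δ = ζ ^ i * δ → g • δ₁ = ζE ^ i * δ₁ := by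
      intro i hi
      have h1 : (g • δ₁ - ζE ^ i * δ₁) * algebraMap (𝓞 K) _ d = 0 := by
        apply hinjE
        push_cast
        rw [show ((algebraMap (𝓞 K) (W.xDivisionField 3) d : W.xDivisionField 3) : AlgebraicClosure K) =
          algebraMap K (AlgebraicClosure K) (algebraMap (𝓞 K) K d) from rfl, sub_mul, hgδ₁val, hi, mul_assoc,
          vζ, hδ₁']
        ring
      rcases mul_eq_zero.mp h1 with h | h
      · exact sub_eq_zero.mp h
      · exact absurd h hd'
    rcases mul_eq_zero.mp hfac with h12 | h3c
    · rcases mul_eq_zero.mp h12 with h1 | h2c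
      · exact sub_eq_zero.mp h1
      · exfalso
        have hg1 := key 1 (by rw [pow_one]; exact sub_eq_zero.mp h2c)
        rw [pow_one] at hg1
        rw [hg1, show ζE * δ₁ - δ₁ = (ζE - 1) * δ₁ by ring] at hmem
        rcases (Ideal.IsPrime.mem_or_mem inferInstance hmem) with h' | h'
        · exact hζm1 h'
        · exact hδ₁u h'
    · exfalso
      have hg2 := key 2 (sub_eq_zero.mp h3c)
      rw [hg2, show ζE ^ 2 * δ₁ - δ₁ = (ζE - 1) * ((ζE + 1) * δ₁) by ring] at hmem
      rcases (Ideal.IsPrime.mem_or_mem inferInstance hmem) with h' | h'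
      · exact hζm1 h'
      · rcases (Ideal.IsPrime.mem_or_mem inferInstance h') with h'' | h''
        · exact hζp1 h''
        · exact hδ₁u h''
  -- `R₀` is fixed: `R₀ ↦ -R₀` contradicts `v(A₀ - γ²) ≥ v(2) + 2 v(2γ)`
  have hfixR₀ : ∀ g, g ∈ (𝔓.comap ((W.xDivisionField 3).integralClosureToAbsIntegers (𝓞 K))).ramificationSubgroup
      (W.xDivisionField 3 ≃ₐ[K] W.xDivisionField 3) 0 → ∀ σ : absoluteGaloisGroup K,
      absRestrictNormalHom (W.xDivisionField 3) σ = g → σ • R₀ = R₀ := by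
    intro g hg σ hσ
    obtain ⟨fζ, fδ⟩ := hfix0 g hg σ hσ
    obtain ⟨s0, -, -⟩ := W.smul_radical_eq_or_eq_neg h₀ h₁ h₂ fζ fδ
    rcases s0 with h | hneg
    · exact h
    exfalso
    have hgP : g • (𝔓.comap ((W.xDivisionField 3).integralClosureToAbsIntegers (𝓞 K))) =
        𝔓.comap ((W.xDivisionField 3).integralClosureToAbsIntegers (𝓞 K)) :=
      (Ideal.mem_ramificationSubgroup_iff.mp hg).1
    have hγσ := hγfix σ fζ fδ
    -- `g (R₀ - γ) = -(R₀ + γ)`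
    have hgz : g • (R₀E - γ) = -(R₀E + γ) := by
      apply hinjE
      rw [hres g σ hσ]
      push_cast
      rw [smul_sub, vR₀, hneg, hγσ]
      ring
    have hordeq : ord (𝔓.comap ((W.xDivisionField 3).integralClosureToAbsIntegers (𝓞 K))) (R₀E + γ) =
        ord (𝔓.comap ((W.xDivisionField 3).integralClosureToAbsIntegers (𝓞 K))) (R₀E - γ) := by
      rw [← ord_neg _ (R₀E + γ), ← hgz, ord_smul _ hgP]
    -- `R₀ - γ ≠ 0`
    have hzne : R₀E - γ ≠ 0 := by
      intro h0
      have hval : R₀ = ((γ : W.xDivisionField 3) : AlgebraicClosure K) := by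
        rw [← vR₀, sub_eq_zero.mp h0]
      have : σ • R₀ = R₀ := by rw [hval]; exact hγσ
      rw [hneg] at this
      exact hRne.1 (by linear_combination -(this) / 2)
    obtain ⟨m, hm⟩ := exists_ord_eq_natCast _ hPE0 hzne
    have hprod : ord (𝔓.comap ((W.xDivisionField 3).integralClosureToAbsIntegers (𝓞 K))) (R₀E ^ 2 - γ ^ 2) =
        ((m + m : ℕ) : ℕ∞) := by
      rw [show R₀E ^ 2 - γ ^ 2 = (R₀E + γ) * (R₀E - γ) by ring, ord_mul _ hPE0, hordeq, hm]; push_cast; rfl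
    have hdiff : (m : ℕ∞) ≤ ord (𝔓.comap ((W.xDivisionField 3).integralClosureToAbsIntegers (𝓞 K))) (2 * γ) := by
      have h := min_ord_le_ord_add (𝔓.comap ((W.xDivisionField 3).integralClosureToAbsIntegers (𝓞 K))) (R₀E + γ) (-(R₀E - γ))
      rw [ord_neg, hordeq, hm, min_self, show R₀E + γ + -(R₀E - γ) = 2 * γ by ring] at h
      exact h
    have hlhs : ord (𝔓.comap ((W.xDivisionField 3).integralClosureToAbsIntegers (𝓞 K))) (2 * (2 * γ) ^ 2) =
        (o : ℕ∞) + (ord (𝔓.comap ((W.xDivisionField 3).integralClosureToAbsIntegers (𝓞 K))) (2 * γ) +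
          ord (𝔓.comap ((W.xDivisionField 3).integralClosureToAbsIntegers (𝓞 K))) (2 * γ)) := by
      rw [ord_mul _ hPE0, ord_pow _ hPE0, hord2, ← two_mul]; push_cast; ring
    have hγ' := hγ
    rw [hlhs, hprod] at hγ'
    -- `o + 2 v(2γ) ≤ 2m` and `m ≤ v(2γ)` with `o ≥ 1`
    have hfin2γ : ord (𝔓.comap ((W.xDivisionField 3).integralClosureToAbsIntegers (𝓞 K))) (2 * γ) ≠ ⊤ := by
      intro ht
      rw [ht, add_top, add_top, top_le_iff] at hγ'
      exact ENat.coe_ne_top _ hγ'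
    obtain ⟨t, ht⟩ := ENat.ne_top_iff_exists.mp hfin2γ
    rw [← ht] at hγ' hdiff
    have e1 : o + (t + t) ≤ m + m := by
      have : ((o + (t + t) : ℕ) : ℕ∞) ≤ ((m + m : ℕ) : ℕ∞) := by push_cast; exact hγ'
      exact_mod_cast this
    have e2 : m ≤ t := by exact_mod_cast hdiff
    omega
  -- ### Step 3: `#Q₀ ≤ 2`, hence `o = #Q₀ = 2`
  obtain ⟨Q0, hQ0⟩ : ∃ Q0 : Subgroup (W.xDivisionField 3 ≃ₐ[K] W.xDivisionField 3),
      Q0 = (𝔓.comap ((W.xDivisionField 3).integralClosureToAbsIntegers (𝓞 K))).ramificationSubgroup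
        (W.xDivisionField 3 ≃ₐ[K] W.xDivisionField 3) 0 := ⟨_, rfl⟩
  have hmem0 : ∀ g, g ∈ Q0 → g ∈ (𝔓.comap ((W.xDivisionField 3).integralClosureToAbsIntegers (𝓞 K))).ramificationSubgroup
      (W.xDivisionField 3 ≃ₐ[K] W.xDivisionField 3) 0 := fun g hg => hQ0 ▸ hg
  have hresf : ∀ (g : W.xDivisionField 3 ≃ₐ[K] W.xDivisionField 3) (σ : absoluteGaloisGroup K),
      absRestrictNormalHom (W.xDivisionField 3) σ = g →
      ∀ e : W.xDivisionField 3, ((g e : W.xDivisionField 3) : AlgebraicClosure K) =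
        σ • (e : AlgebraicClosure K) := by
    intro g σ hσ e
    rw [← hσ]
    exact AlgEquiv.restrictNormal_commutes (absoluteGaloisGroup.toAlgEquiv K σ) (W.xDivisionField 3) e
  have hval : ∀ (g : W.xDivisionField 3 ≃ₐ[K] W.xDivisionField 3) (σ : absoluteGaloisGroup K),
      absRestrictNormalHom (W.xDivisionField 3) σ = g → ∀ (R : AlgebraicClosure K) (hR : R ∈ W.xDivisionField 3),
      (g ⟨R, hR⟩ = ⟨R, hR⟩ ↔ σ • R = R) := by
    intro g σ hσ R hR
    rw [Subtype.ext_iff, hresf g σ hσ]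
  -- two elements of `Q₀` with the same sign on `R₁` coincide
  have hdet : ∀ g g' : W.xDivisionField 3 ≃ₐ[K] W.xDivisionField 3, g ∈ Q0 → g' ∈ Q0 →
      ((g ⟨R₁, mR₁⟩ = ⟨R₁, mR₁⟩) ↔ (g' ⟨R₁, mR₁⟩ = ⟨R₁, mR₁⟩)) → g = g' := by
    intro g g' hg hg' e1
    obtain ⟨σ, hσ⟩ := absRestrictNormalHom_surjective' (W.xDivisionField 3) g
    obtain ⟨σ', hσ'⟩ := absRestrictNormalHom_surjective' (W.xDivisionField 3) g'
    obtain ⟨fζ, fδ⟩ := hfix0 g (hmem0 g hg) σ hσ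
    obtain ⟨fζ', fδ'⟩ := hfix0 g' (hmem0 g' hg') σ' hσ'
    obtain ⟨-, s1, -⟩ := W.smul_radical_eq_or_eq_neg h₀ h₁ h₂ fζ fδ
    obtain ⟨-, s1', -⟩ := W.smul_radical_eq_or_eq_neg h₀ h₁ h₂ fζ' fδ'
    rw [hval g σ hσ, hval g' σ' hσ'] at e1
    have a0 : σ • R₀ = σ' • R₀ := by
      rw [hfixR₀ g (hmem0 g hg) σ hσ, hfixR₀ g' (hmem0 g' hg') σ' hσ']
    have a1 : σ • R₁ = σ' • R₁ := by
      rcases s1 with h | h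
      · rw [h, e1.mp h]
      · rcases s1' with h' | h'
        · rw [h', e1.mpr h']
        · rw [h, h']
    exact W.algEquiv_xDivisionField_three_eq_of_smul_radical_eq hζ hδ h₀ h₁ h₂ hρ hc₆ hσ hσ' a0 a1
  let f : Q0 → Bool := fun g =>
    decide ((g : W.xDivisionField 3 ≃ₐ[K] W.xDivisionField 3) ⟨R₁, mR₁⟩ = ⟨R₁, mR₁⟩)
  have hf_inj : Function.Injective f := by
    rintro ⟨g, hg⟩ ⟨g', hg'⟩ hgg'
    simp only [f, decide_eq_decide] at hgg'
    exact Subtype.ext (hdet g g' hg hg' hgg')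
  have hle2 : Nat.card Q0 ≤ 2 := by
    have h := Nat.card_le_card_of_injective f hf_inj
    rwa [show Nat.card Bool = 2 by simp] at h
  have ho2 : o = 2 := by
    have hoQ : o = Nat.card Q0 := by rw [ho, hQ0]
    obtain ⟨k, hk⟩ := hoeven
    omega
  
  -- ### Step 4: `Q₀ = Q₁ = {1, τ}`, `τR₁ = -R₁`, `i(τ) = 3`, `2 φ_E(4) = 6`
  have hr₁a : r₁ = a := by rw [ho2] at h2r₁; omega
  have hr₂a : r₂ = a := by rw [ho2] at h2r₂; omega
  have hcardQ0 : Nat.card Q0 = 2 := by rw [hQ0, ← ho, ho2]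
  have h1Q0 : (1 : W.xDivisionField 3 ≃ₐ[K] W.xDivisionField 3) ∈ Q0 := Subgroup.one_mem _
  haveI hntQ0 : Nontrivial Q0 := Finite.one_lt_card_iff_nontrivial.mp (by rw [hcardQ0]; norm_num)
  obtain ⟨⟨τ, hτQ⟩, hτ1'⟩ := exists_ne (1 : Q0)
  have hτ1 : τ ≠ 1 := fun h => hτ1' (Subtype.ext h)
  have hτR₁ : τ ⟨R₁, mR₁⟩ ≠ ⟨R₁, mR₁⟩ := by
    intro h
    exact hτ1 (hdet τ 1 hτQ h1Q0 ⟨fun _ => rfl, fun _ => h⟩)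
  have hQ0elts : ∀ g, g ∈ Q0 → g = 1 ∨ g = τ := by
    intro g hg
    by_cases hgR : g ⟨R₁, mR₁⟩ = ⟨R₁, mR₁⟩
    · exact Or.inl (hdet g 1 hg h1Q0 ⟨fun _ => rfl, fun _ => hgR⟩)
    · exact Or.inr (hdet g τ hg hτQ ⟨fun h => absurd h hgR, fun h => absurd h hτR₁⟩)
  obtain ⟨στ, hστ⟩ := absRestrictNormalHom_surjective' (W.xDivisionField 3) τ
  have hτ0 : τ ∈ (𝔓.comap ((W.xDivisionField 3).integralClosureToAbsIntegers (𝓞 K))).ramificationSubgroup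
      (W.xDivisionField 3 ≃ₐ[K] W.xDivisionField 3) 0 := hmem0 τ hτQ
  obtain ⟨fζτ, fδτ⟩ := hfix0 τ hτ0 στ hστ
  have hστR₁ : στ • R₁ = -R₁ := by
    obtain ⟨-, s1, -⟩ := W.smul_radical_eq_or_eq_neg h₀ h₁ h₂ fζτ fδτ
    rcases s1 with h | h
    · exact absurd ((hval τ στ hστ R₁ mR₁).mpr h) hτR₁
    · exact h
  -- `Q₁ = Q₀`
  have hQ1eq : (𝔓.comap ((W.xDivisionField 3).integralClosureToAbsIntegers (𝓞 K))).ramificationSubgroup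
      (W.xDivisionField 3 ≃ₐ[K] W.xDivisionField 3) 1 = Q0 := by
    have hcard1 := card_ramificationSubgroup_one_eq_two_pow_of_mem_primesAbove hv2 h𝔓 (W.xDivisionField 3)
    rw [← ho, ho2, Nat.Prime.factorization_self Nat.prime_two, pow_one] at hcard1
    apply Subgroup.eq_of_le_of_card_ge
    · rw [hQ0]; exact Ideal.ramificationSubgroup_antitone _ _ (Nat.zero_le 1)
    · rw [hcardQ0, hcard1]
  have hτ1mem : τ ∈ (𝔓.comap ((W.xDivisionField 3).integralClosureToAbsIntegers (𝓞 K))).ramificationSubgroup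
      (W.xDivisionField 3 ≃ₐ[K] W.xDivisionField 3) 1 := by rw [hQ1eq]; exact hτQ
  -- `i(τ) = 3`
  have hτR₁E' : τ • R₁E = -R₁E := by
    apply hinjE
    rw [hres τ στ hστ]
    push_cast
    rw [vR₁, hστR₁]
  have hτR₁E : τ • R₁E - R₁E = -(2 * R₁E) := by rw [hτR₁E']; ring
  have haE : ((a : ℕ) : integralClosure (𝓞 K) (W.xDivisionField 3)) ∉
      𝔓.comap ((W.xDivisionField 3).integralClosureToAbsIntegers (𝓞 K)) := by
    have h := W.intCast_notMem_of_odd hv2 h𝔓 (m := (a : ℤ)) (by exact_mod_cast ha)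
    push_cast at h
    exact h
  have hiτ : lowerIndex (𝔓.comap ((W.xDivisionField 3).integralClosureToAbsIntegers (𝓞 K)))
      (W.xDivisionField 3 ≃ₐ[K] W.xDivisionField 3) τ = ((3 : ℕ) : ℕ∞) := by
    have hm : ord (𝔓.comap ((W.xDivisionField 3).integralClosureToAbsIntegers (𝓞 K))) (τ • R₁E - R₁E) =
        ((o + a : ℕ) : ℕ∞) := by
      rw [hτR₁E, ord_neg, ord_mul _ hPE0, hord2, hr₁, hr₁a]; push_cast; rfl
    have hx : ord (𝔓.comap ((W.xDivisionField 3).integralClosureToAbsIntegers (𝓞 K))) R₁E = (a : ℕ) := by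
      rw [hr₁, hr₁a]
    have h := (lowerIndex_eq_of_ord_smul_sub_eq hPE0 hτ1mem hm hx haE).2
    rw [h, ho2, show 2 + a - a = 2 by omega]
    rfl
  -- `2 φ_E(4) = 6`
  have hphi : herbrandPhi (𝔓.comap ((W.xDivisionField 3).integralClosureToAbsIntegers (𝓞 K)))
      (W.xDivisionField 3 ≃ₐ[K] W.xDivisionField 3) (4 : ℝ) = 3 := by
    have hT₁ : ∀ s, s ∈ ({τ} : Finset (W.xDivisionField 3 ≃ₐ[K] W.xDivisionField 3)) ↔
        s ∈ (𝔓.comap ((W.xDivisionField 3).integralClosureToAbsIntegers (𝓞 K))).ramificationSubgroup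
          (W.xDivisionField 3 ≃ₐ[K] W.xDivisionField 3) 1 ∧ s ≠ 1 := by
      intro s
      rw [Finset.mem_singleton, hQ1eq]
      constructor
      · rintro rfl; exact ⟨hτQ, hτ1⟩
      · rintro ⟨hs, hs1⟩
        rcases hQ0elts s hs with h | h
        · exact absurd h hs1
        · exact h
    have h := card_mul_herbrandPhi_eq_of_lowerIndex_eq_of_wild
      (𝔓.comap ((W.xDivisionField 3).integralClosureToAbsIntegers (𝓞 K))) (b := 4)
      ({τ} : Finset (W.xDivisionField 3 ≃ₐ[K] W.xDivisionField 3)) hT₁ (fun _ => 3)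
      (fun s hs => by rw [Finset.mem_singleton] at hs; rw [hs, hiτ]) (fun _ _ => by norm_num)
    rw [← ho, ho2, Finset.sum_singleton] at h
    simp only [Nat.cast_ofNat] at h
    linarith
  
  -- ### Step 5: the layer `L = K(E[3]) ⊇ E`: `v_{𝔓_L} = e' v_{𝔓_E}` on `S_E`
  have hle : W.xDivisionField 3 ≤ W.divisionField 3 := W.xDivisionField_le_divisionField 3
  have hinjF : ∀ {X Y : integralClosure (𝓞 K) (W.divisionField 3)},
      ((X : W.divisionField 3) : AlgebraicClosure K) = ((Y : W.divisionField 3) : AlgebraicClosure K) → X = Y :=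
    fun h => Subtype.ext (Subtype.ext h)
  letI algFr : Algebra (integralClosure (𝓞 K) (IntermediateField.restrict hle))
      (integralClosure (𝓞 K) (W.divisionField 3)) :=
    integralClosureAlgebra (𝓞 K) (IntermediateField.restrict hle)
  obtain ⟨eR, heR⟩ : ∃ eR : integralClosure (𝓞 K) (W.xDivisionField 3) ≃+* integralClosure (𝓞 K) (IntermediateField.restrict hle),
      eR = ((IntermediateField.restrict_algEquiv hle).restrictScalars (𝓞 K)).mapIntegralClosure.toRingEquiv := ⟨_, rfl⟩
  obtain ⟨𝔓Fr, h𝔓Fr⟩ : ∃ 𝔓Fr : Ideal (integralClosure (𝓞 K) (IntermediateField.restrict hle)),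
      𝔓Fr = @Ideal.under _ _ _ _ algFr (𝔓.comap ((W.divisionField 3).integralClosureToAbsIntegers (𝓞 K))) :=
    ⟨_, rfl⟩
  have hcomap : 𝔓Fr.comap (eR : integralClosure (𝓞 K) (W.xDivisionField 3) →+* integralClosure (𝓞 K) (IntermediateField.restrict hle)) =
      𝔓.comap ((W.xDivisionField 3).integralClosureToAbsIntegers (𝓞 K)) := by
    rw [h𝔓Fr, heR, Ideal.under_def]
    exact comap_restrict_mapIntegralClosure (𝓞 K) hle 𝔓
  have hjval : ∀ X : integralClosure (𝓞 K) (W.xDivisionField 3),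
      (((algebraMap (integralClosure (𝓞 K) (IntermediateField.restrict hle))
          (integralClosure (𝓞 K) (W.divisionField 3)) (eR X) : integralClosure (𝓞 K) (W.divisionField 3)) :
          W.divisionField 3) : AlgebraicClosure K) =
        ((X : W.xDivisionField 3) : AlgebraicClosure K) := fun X => by rw [heR]; rfl
  obtain ⟨e', he'⟩ : ∃ e' : ℕ, e' = @Ideal.ramificationIdx' _ _ _ _ algFr 𝔓Fr
      (𝔓.comap ((W.divisionField 3).integralClosureToAbsIntegers (𝓞 K))) := ⟨_, rfl⟩
  have htr : ∀ X : integralClosure (𝓞 K) (W.xDivisionField 3),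
      ord (𝔓.comap ((W.divisionField 3).integralClosureToAbsIntegers (𝓞 K)))
          (algebraMap (integralClosure (𝓞 K) (IntermediateField.restrict hle))
            (integralClosure (𝓞 K) (W.divisionField 3)) (eR X)) =
        e' * ord (𝔓.comap ((W.xDivisionField 3).integralClosureToAbsIntegers (𝓞 K))) X := by
    intro X
    haveI := hPFmax
    haveI : IsDedekindDomain (integralClosure (𝓞 K) (IntermediateField.restrict hle)) :=
      integralClosure.isDedekindDomain (𝓞 K) K (IntermediateField.restrict hle)
    have hh := ord_algebraMap_integralClosure (𝓞 K) (IntermediateField.restrict hle) (K := K)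
      (L := W.divisionField 3) _ hPF0 (eR X)
    have h3 := hcomap
    rw [h𝔓Fr] at h3
    have h4 := ord_comap_ringEquiv_eq eR
      (@Ideal.under _ _ _ _ algFr (𝔓.comap ((W.divisionField 3).integralClosureToAbsIntegers (𝓞 K)))) X
    refine hh.trans ?_
    rw [he', h𝔓Fr]
    congr 1
    exact h4.symm.trans (congrArg (fun Q => ord Q X) h3)
  have hcomp : ∀ r : 𝓞 K,
      algebraMap (integralClosure (𝓞 K) (IntermediateField.restrict hle))
          (integralClosure (𝓞 K) (W.divisionField 3))
          (eR (algebraMap (𝓞 K) (integralClosure (𝓞 K) (W.xDivisionField 3)) r)) =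
        algebraMap (𝓞 K) (integralClosure (𝓞 K) (W.divisionField 3)) r := by
    intro r
    apply hinjF
    rw [hjval]
    rfl
  -- `v_{𝔓_L}(2) = e' o = 2 e' = #G₀(L)`, so `L` is wildly ramified at `𝔓`
  have h2L : ord (𝔓.comap ((W.divisionField 3).integralClosureToAbsIntegers (𝓞 K)))
      (2 : integralClosure (𝓞 K) (W.divisionField 3)) = ((e' * o : ℕ) : ℕ∞) := by
    have h := htr 2
    rw [hord2] at h
    have e2 : algebraMap (integralClosure (𝓞 K) (IntermediateField.restrict hle))
        (integralClosure (𝓞 K) (W.divisionField 3)) (eR 2) = 2 := by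
      have h1 := hcomp 2
      rw [map_ofNat (algebraMap (𝓞 K) (integralClosure (𝓞 K) (W.xDivisionField 3))) 2,
        map_ofNat (algebraMap (𝓞 K) (integralClosure (𝓞 K) (W.divisionField 3))) 2] at h1
      exact h1
    rw [e2] at h
    rw [h]; push_cast; rfl
  have hcardL : Nat.card ((𝔓.comap ((W.divisionField 3).integralClosureToAbsIntegers (𝓞 K))).ramificationSubgroup
      (W.divisionField 3 ≃ₐ[K] W.divisionField 3) 0) = e' * o := by
    have h := ord_algebraMap_eq_card_inertia_of_mem_primesAbove h𝔓 (W.divisionField 3) (π := 2) hv2 hv4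
    rw [map_ofNat, h2L] at h
    exact ((Nat.cast_injective (R := ℕ∞)) h).symm
  have hne : (𝔓.comap ((W.divisionField 3).integralClosureToAbsIntegers (𝓞 K))).ramificationSubgroup
      (W.divisionField 3 ≃ₐ[K] W.divisionField 3) 1 ≠ ⊥ := by
    have hcard1 := card_ramificationSubgroup_one_eq_two_pow_of_mem_primesAbove hv2 h𝔓 (W.divisionField 3)
    rw [hcardL, ho2] at hcard1
    have he'pos : e' * 2 ≠ 0 := by
      intro h0
      rw [ho2, h0] at h2L
      have h1 : (1 : ℕ∞) ≤ ord (𝔓.comap ((W.divisionField 3).integralClosureToAbsIntegers (𝓞 K)))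
          (2 : integralClosure (𝓞 K) (W.divisionField 3)) := by
        rw [show (1 : ℕ∞) = ((1 : ℕ) : ℕ∞) from rfl, ← mem_pow_iff_le_ord, pow_one]
        have : (2 : 𝓞 K) ∈ (𝔓.comap ((W.divisionField 3).integralClosureToAbsIntegers (𝓞 K))).under (𝓞 K) := by
          rw [hunderF]; exact hv2
        rw [Ideal.under_def, Ideal.mem_comap, map_ofNat] at this
        exact this
      rw [h2L] at h1
      have : (1 : ℕ) ≤ 0 := by exact_mod_cast h1
      omega
    have hfac : 1 ≤ (e' * 2).factorization 2 :=
      (Nat.Prime.dvd_iff_one_le_factorization Nat.prime_two he'pos).mp (dvd_mul_left 2 e')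
    intro hbot
    rw [hbot, Subgroup.card_bot] at hcard1
    have : 2 ≤ 2 ^ (e' * 2).factorization 2 := by
      calc (2 : ℕ) = 2 ^ 1 := by norm_num
        _ ≤ 2 ^ (e' * 2).factorization 2 := Nat.pow_le_pow_right (by norm_num) hfac
    omega
  -- the involution `ι`
  obtain ⟨ι, hι1, hιne, hιsq, hι⟩ := W.exists_central_involution_divisionField_three hv2 h3 h𝔓 hne
  -- ### Step 6: the Kummer element `w = 108(2y₁ + a₁x₁ + a₃)` with `w² = Y₀ = 54(R₀+R₁)(R₁+R₂)(R₂+R₀)`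
  obtain ⟨eb₂, ec₄, ec₆, eΔ⟩ := W.baseChange_algebraicClosure_invariants
  set W' := W.baseChange (AlgebraicClosure K) with hW'
  set b₂' : AlgebraicClosure K := algebraMap K (AlgebraicClosure K) W.b₂ with hb₂'
  set x₁ : AlgebraicClosure K := (-b₂' + R₀ + R₁ + R₂) / 12 with hx₁def
  have hX₁ : 3 * (R₀ + R₁ + R₂) = 36 * x₁ + 3 * b₂' := by rw [hx₁def]; field_simp; ring
  set Y₀ : integralClosure (𝓞 K) (W.xDivisionField 3) := 54 * ((R₀E + R₁E) * ((R₁E + R₂E) * (R₂E + R₀E))) with hY₀def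
  have hY₀ : ((Y₀ : W.xDivisionField 3) : AlgebraicClosure K) =
      (3 * (R₀ + R₁ + R₂)) ^ 3 - 27 * algebraMap K _ W.c₄ * (3 * (R₀ + R₁ + R₂)) - 54 * algebraMap K _ W.c₆ := by
    rw [hY₀def]
    push_cast
    simp only [hS54]
    rw [vR₀, vR₁, vR₂]
    linear_combination (-(27 * (R₀ + R₁ + R₂))) * h₀ + (-(27 * (R₀ + R₁ + R₂))) * h₁ +
      (-(27 * (R₀ + R₁ + R₂))) * h₂ + (324 * (R₀ + R₁ + R₂) * δ) * hζ + (-(54 : AlgebraicClosure K)) * hρ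
  -- `v_{𝔓_E}(Y₀) = o + 3 r₁ = 2 + 3a`
  have h27 : (27 : integralClosure (𝓞 K) (W.xDivisionField 3)) ∉
      𝔓.comap ((W.xDivisionField 3).integralClosureToAbsIntegers (𝓞 K)) := by
    have := three_pow_notMem (P := 𝔓.comap ((W.xDivisionField 3).integralClosureToAbsIntegers (𝓞 K))) h3E 3
    norm_num at this
    exact this
  have h54 : ord (𝔓.comap ((W.xDivisionField 3).integralClosureToAbsIntegers (𝓞 K)))
      (54 : integralClosure (𝓞 K) (W.xDivisionField 3)) = (o : ℕ∞) := by
    rw [show (54 : integralClosure (𝓞 K) (W.xDivisionField 3)) = 2 * 27 by norm_num, ord_mul _ hPE0, hord2,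
      (ord_eq_zero_iff _).mpr h27, add_zero]
  have h01 : ord (𝔓.comap ((W.xDivisionField 3).integralClosureToAbsIntegers (𝓞 K))) (R₀E + R₁E) = (r₁ : ℕ∞) := by
    rw [← hr₁]
    apply ord_add_eq_of_lt
    rw [hr₁, hr₀]; exact_mod_cast hr₀gt
  have h20 : ord (𝔓.comap ((W.xDivisionField 3).integralClosureToAbsIntegers (𝓞 K))) (R₂E + R₀E) = (r₁ : ℕ∞) := by
    rw [add_comm, ← hr₂a.trans hr₁a.symm, ← hr₂]
    apply ord_add_eq_of_lt
    rw [hr₂, hr₀, hr₂a, ← hr₁a]; exact_mod_cast hr₀gt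
  have hu12 : u₁ - u₂ = 3 * ζE * (ζE - 1) * δ₁ := by
    have h2a : ((2 : integralClosure (𝓞 K) (W.xDivisionField 3)) ^ a) ≠ 0 := pow_ne_zero _ two_ne_zero
    have hdiffsq : (2 : integralClosure (𝓞 K) (W.xDivisionField 3)) ^ a * (u₁ - u₂ - 3 * ζE * (ζE - 1) * δ₁) = 0 := by
      have e1 : (2 : integralClosure (𝓞 K) (W.xDivisionField 3)) ^ a * (u₁ - u₂) = R₁E ^ 2 - R₂E ^ 2 := by
        rw [hR₁sq, hR₂sq]; ring
      have e2 : R₁E ^ 2 - R₂E ^ 2 = (2 : integralClosure (𝓞 K) (W.xDivisionField 3)) ^ a * (3 * ζE * (ζE - 1) * δ₁) := by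
        apply hinjE
        push_cast
        simp only [hS2, hS3]
        rw [vR₁, vR₂, vζ, h₁, h₂, haq, ← vδ₁]
        ring
      linear_combination e1 + e2
    rcases mul_eq_zero.mp hdiffsq with h | h
    · exact absurd h h2a
    · linear_combination h
  have hu12u : u₁ - u₂ ∉ 𝔓.comap ((W.xDivisionField 3).integralClosureToAbsIntegers (𝓞 K)) := by
    rw [hu12]
    intro h
    rcases (Ideal.IsPrime.mem_or_mem inferInstance h) with ha' | hb'
    · rcases (Ideal.IsPrime.mem_or_mem inferInstance ha') with hc' | hd'
      · rcases (Ideal.IsPrime.mem_or_mem inferInstance hc') with he' | hf'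
        · exact h3E he'
        · exact hζunit hf'
      · exact hζm1 hd'
    · exact hδ₁u hb'
  have h12 : ord (𝔓.comap ((W.xDivisionField 3).integralClosureToAbsIntegers (𝓞 K))) (R₁E + R₂E) = (r₁ : ℕ∞) := by
    -- `(R₁ + R₂)(R₁ - R₂) = 2^a (u₁ - u₂)` has order `a o = 2 r₁`, both factors have order `≥ r₁`
    have hprod : ord (𝔓.comap ((W.xDivisionField 3).integralClosureToAbsIntegers (𝓞 K))) (R₁E + R₂E) +
        ord (𝔓.comap ((W.xDivisionField 3).integralClosureToAbsIntegers (𝓞 K))) (R₁E - R₂E) = ((r₁ + r₁ : ℕ) : ℕ∞) := by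
      rw [← ord_mul _ hPE0, show (R₁E + R₂E) * (R₁E - R₂E) = R₁E ^ 2 - R₂E ^ 2 by ring, hR₁sq, hR₂sq,
        ← mul_sub, ord_mul _ hPE0, hord2a, (ord_eq_zero_iff _).mpr hu12u, add_zero, ← h2r₁]; push_cast; ring
    have hge1 : (r₁ : ℕ∞) ≤ ord (𝔓.comap ((W.xDivisionField 3).integralClosureToAbsIntegers (𝓞 K))) (R₁E + R₂E) := by
      have h := min_ord_le_ord_add (𝔓.comap ((W.xDivisionField 3).integralClosureToAbsIntegers (𝓞 K))) R₁E R₂E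
      rwa [hr₁, hr₂, hr₂a, ← hr₁a, min_self] at h
    have hge2 : (r₁ : ℕ∞) ≤ ord (𝔓.comap ((W.xDivisionField 3).integralClosureToAbsIntegers (𝓞 K))) (R₁E - R₂E) := by
      have h := min_ord_le_ord_add (𝔓.comap ((W.xDivisionField 3).integralClosureToAbsIntegers (𝓞 K))) R₁E (-R₂E)
      rwa [ord_neg, hr₁, hr₂, hr₂a, ← hr₁a, min_self, ← sub_eq_add_neg] at h
    have hfin1 : ord (𝔓.comap ((W.xDivisionField 3).integralClosureToAbsIntegers (𝓞 K))) (R₁E + R₂E) ≠ ⊤ := by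
      intro ht; rw [ht, top_add] at hprod; exact ENat.coe_ne_top _ hprod.symm
    have hfin2 : ord (𝔓.comap ((W.xDivisionField 3).integralClosureToAbsIntegers (𝓞 K))) (R₁E - R₂E) ≠ ⊤ := by
      intro ht; rw [ht, add_top] at hprod; exact ENat.coe_ne_top _ hprod.symm
    obtain ⟨p₁, hp₁⟩ := ENat.ne_top_iff_exists.mp hfin1
    obtain ⟨p₂, hp₂⟩ := ENat.ne_top_iff_exists.mp hfin2
    rw [← hp₁, ← hp₂] at hprod
    rw [← hp₁] at hge1 ⊢
    rw [← hp₂] at hge2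
    have e1 : p₁ + p₂ = r₁ + r₁ := by exact_mod_cast hprod
    have e2 : r₁ ≤ p₁ := by exact_mod_cast hge1
    have e3 : r₁ ≤ p₂ := by exact_mod_cast hge2
    congr 1; omega
  set n₀ : ℕ := o + (r₁ + (r₁ + r₁)) with hn₀def
  have hn₀ : ord (𝔓.comap ((W.xDivisionField 3).integralClosureToAbsIntegers (𝓞 K))) Y₀ = (n₀ : ℕ∞) := by
    rw [hY₀def, ord_mul _ hPE0, h54, ord_mul _ hPE0, h01, ord_mul _ hPE0, h12, h20, hn₀def]; push_cast; ring
  have hn₀odd : Odd n₀ := by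
    rw [hn₀def, ho2, hr₁a, show 2 + (a + (a + a)) = 2 * (a + 1) + a by ring]
    exact Even.add_odd (even_two_mul _) ha
  have hn₀u : ((n₀ : ℕ) : integralClosure (𝓞 K) (W.xDivisionField 3)) ∉
      𝔓.comap ((W.xDivisionField 3).integralClosureToAbsIntegers (𝓞 K)) := by
    have h := W.intCast_notMem_of_odd hv2 h𝔓 (m := (n₀ : ℤ)) (by exact_mod_cast hn₀odd)
    push_cast at h
    exact h
  
  -- ### Step 7: the `3`-torsion point above `x₁`, `w = 108(2y₁ + a₁x₁ + a₃)`, `b = i(ι) - 1 = 4`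
  have hb : lowerIndex (𝔓.comap ((W.divisionField 3).integralClosureToAbsIntegers (𝓞 K)))
      (W.divisionField 3 ≃ₐ[K] W.divisionField 3) ι = ((4 : ℕ) : ℕ∞) + 1 := by
    have e₁ : 12 * x₁ = -algebraMap K (AlgebraicClosure K) W.b₂ + 1 * R₀ + 1 * R₁ + 1 * R₂ := by
      rw [← hb₂', hx₁def]; field_simp
    obtain ⟨T₁, y₁, hns₁, hT₁⟩ := W.exists_geomTorsion_three_eq_some_of_radical h2K h3K hζ h₀ h₁ h₂ hρ
      (Or.inl rfl) (Or.inl rfl) (Or.inl rfl) (by norm_num) e₁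
    obtain ⟨hx₁F, hy₁F⟩ := W.mem_divisionField_of_eq_some 3 hT₁
    have ha₁ : W'.a₁ = algebraMap K (AlgebraicClosure K) W.a₁ := rfl
    have ha₃ : W'.a₃ = algebraMap K (AlgebraicClosure K) W.a₃ := rfl
    set wval : AlgebraicClosure K := 108 * (2 * y₁ + W'.a₁ * x₁ + W'.a₃) with hwval
    have hwsq : wval ^ 2 = ((Y₀ : W.xDivisionField 3) : AlgebraicClosure K) := by
      have h1 := W'.sq_two_mul_add_eq_of_equation hns₁.left
      have h2 := W'.mul_Ψ₂Sq_eval_eq x₁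
      rw [hY₀, hX₁, hwval, ← eb₂, ← ec₄, ← ec₆]
      linear_combination (11664 : AlgebraicClosure K) * h1 + 27 * h2
    have hwF : wval ∈ W.divisionField 3 := by
      rw [hwval, ha₁, ha₃]
      refine mul_mem (by exact_mod_cast (W.divisionField 3).natCast_mem 108) ?_
      refine add_mem (add_mem (mul_mem (by exact_mod_cast (W.divisionField 3).natCast_mem 2) hy₁F)
        (mul_mem ((W.divisionField 3).algebraMap_mem _) hx₁F)) ((W.divisionField 3).algebraMap_mem _)
    have hY₀int : _root_.IsIntegral (𝓞 K) (⟨wval, hwF⟩ : W.divisionField 3) := by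
      have hsq : (⟨wval, hwF⟩ : W.divisionField 3) ^ 2 =
          IntermediateField.inclusion hle (Y₀ : W.xDivisionField 3) := by
        apply Subtype.ext
        change wval ^ 2 = ((Y₀ : W.xDivisionField 3) : AlgebraicClosure K)
        exact hwsq
      refine _root_.IsIntegral.of_pow two_pos ?_
      rw [hsq]
      exact (Y₀.2).map (IntermediateField.inclusion hle)
    set w₀ : integralClosure (𝓞 K) (W.divisionField 3) := ⟨⟨wval, hwF⟩, hY₀int⟩ with hw₀
    -- a lift `σ` of `ι` and its action on the coordinates
    obtain ⟨σ, hσ⟩ := absRestrictNormalHom_surjective' (W.divisionField 3) ι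
    obtain ⟨hσx, hσy⟩ := W.smul_coord_of_smul_eq_neg (ℓ := 3) (hι σ hσ T₁) hT₁
    have hσw : σ • wval = -wval := by
      rw [hwval, smul_mul', smul_add, smul_add, smul_mul', smul_mul', hσx, hσy, ha₁, ha₃,
        smul_algebraMap, smul_algebraMap]
      have e108 := hnumσ σ 108
      have e2 := hnumσ σ 2
      push_cast at e108 e2
      rw [e108, e2]
      ring
    have hresF : ∀ X : integralClosure (𝓞 K) (W.divisionField 3),
        (((ι • X : integralClosure (𝓞 K) (W.divisionField 3)) : W.divisionField 3) : AlgebraicClosure K) =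
          σ • ((X : W.divisionField 3) : AlgebraicClosure K) := by
      intro X
      rw [integralClosure.coe_smul, ← hσ]
      exact AlgEquiv.restrictNormal_commutes (absoluteGaloisGroup.toAlgEquiv K σ) (W.divisionField 3) X
    have hιw : ι • w₀ = -w₀ := by
      apply hinjF
      rw [hresF]
      push_cast
      have hw₀val : ((w₀ : W.divisionField 3) : AlgebraicClosure K) = wval := rfl
      rw [hw₀val, hσw]
    -- `e(𝔓_L | 𝔓_{L'}) = #{1, ι} = 2`
    haveI : Normal K (IntermediateField.restrict hle) :=
      Normal.of_algEquiv (IntermediateField.restrict_algEquiv hle)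
    have hkerE := W.absRestrictNormalHom_xDivisionField_eq_one_iff_divisionField hι
    have hker := restrictNormalHom_restrict_eq_one_iff (W.divisionField 3) (W.xDivisionField 3) hle hkerE
    have hH : ∀ g : W.divisionField 3 ≃ₐ[K] W.divisionField 3,
        g ∈ (IntermediateField.restrict hle).fixingSubgroup ↔ g = 1 ∨ g = ι := by
      intro g
      rw [← IntermediateField.restrictNormalHom_ker, MonoidHom.mem_ker]
      exact hker g
    have hι0 : ι ∈ (𝔓.comap ((W.divisionField 3).integralClosureToAbsIntegers (𝓞 K))).ramificationSubgroup
        (W.divisionField 3 ≃ₐ[K] W.divisionField 3) 0 :=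
      Ideal.ramificationSubgroup_antitone _ _ (Nat.zero_le 1) hι1
    have hιH : ι ∈ (IntermediateField.restrict hle).fixingSubgroup := (hH ι).mpr (Or.inr rfl)
    have hcardI : Nat.card ((𝔓.comap ((W.divisionField 3).integralClosureToAbsIntegers (𝓞 K))).inertia
        (IntermediateField.restrict hle).fixingSubgroup) = 2 := by
      have hset : ∀ x : (IntermediateField.restrict hle).fixingSubgroup,
          x ∈ (𝔓.comap ((W.divisionField 3).integralClosureToAbsIntegers (𝓞 K))).inertia
              (IntermediateField.restrict hle).fixingSubgroup ↔
            (x : W.divisionField 3 ≃ₐ[K] W.divisionField 3) = 1 ∨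
              (x : W.divisionField 3 ≃ₐ[K] W.divisionField 3) = ι := by
        intro x
        rw [← Ideal.ramificationSubgroup_zero, mem_ramificationSubgroup_subgroup_iff]
        constructor
        · intro _
          exact (hH x).mp x.2
        · rintro (hx | hx)
          · rw [hx]; exact Subgroup.one_mem _
          · rw [hx]; exact hι0
      let eqv : ((𝔓.comap ((W.divisionField 3).integralClosureToAbsIntegers (𝓞 K))).inertia
          (IntermediateField.restrict hle).fixingSubgroup) ≃ Bool :=
        { toFun := fun x => if ((x : (IntermediateField.restrict hle).fixingSubgroup) :
              W.divisionField 3 ≃ₐ[K] W.divisionField 3) = 1 then false else true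
          invFun := fun b => if b then ⟨⟨ι, hιH⟩, (hset _).mpr (Or.inr rfl)⟩
            else ⟨1, Subgroup.one_mem _⟩
          left_inv := by
            rintro ⟨x, hx⟩
            rcases (hset x).mp hx with h1 | h1
            · have : x = 1 := Subtype.ext h1
              subst this
              simp
            · have hx1 : (x : W.divisionField 3 ≃ₐ[K] W.divisionField 3) ≠ 1 := by rw [h1]; exact hιne
              simp only [hx1, if_false, if_true]
              congr 1
              exact Subtype.ext h1.symm
          right_inv := by
            rintro (_ | _)
            · simp
            · simp [hιne] }
      rw [Nat.card_congr eqv, Nat.card_eq_fintype_card, Fintype.card_bool]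
    haveI : Finite ((𝓞 K) ⧸ 𝔓.under (𝓞 K)) := by
      rw [← h𝔓.2.over]; exact Ideal.finiteQuotientOfFreeOfNeBot v.asIdeal v.ne_bot
    haveI hsepF : Algebra.IsSeparable
        ((𝓞 K) ⧸ (𝔓.comap ((W.divisionField 3).integralClosureToAbsIntegers (𝓞 K))).under (𝓞 K))
        (integralClosure (𝓞 K) (W.divisionField 3) ⧸
          𝔓.comap ((W.divisionField 3).integralClosureToAbsIntegers (𝓞 K))) :=
      isSeparable_residue_comap (𝓞 K) 𝔓 (W.divisionField 3)
    have he2 : e' = 2 := by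
      have hidx := ramificationIdx'_under_eq_card_inertia (𝓞 K) (IntermediateField.restrict hle) (K := K)
        (L := W.divisionField 3) _ hPF0
      rw [he', h𝔓Fr]
      exact hidx.trans hcardI
    -- orders in `S_L`
    have hw₀sq : w₀ ^ 2 = algebraMap (integralClosure (𝓞 K) (IntermediateField.restrict hle))
        (integralClosure (𝓞 K) (W.divisionField 3)) (eR Y₀) := by
      apply hinjF
      rw [hjval, ← hwsq]
      rfl
    have hordw₀ : ord (𝔓.comap ((W.divisionField 3).integralClosureToAbsIntegers (𝓞 K))) w₀ = n₀ := by
      have h := ord_mul _ hPF0 w₀ w₀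
      rw [← sq, hw₀sq, htr, hn₀, he2] at h
      have hfin : ord (𝔓.comap ((W.divisionField 3).integralClosureToAbsIntegers (𝓞 K))) w₀ ≠ ⊤ := by
        intro ht
        rw [ht, top_add] at h
        exact ENat.coe_ne_top (2 * n₀) (by exact_mod_cast h)
      obtain ⟨c, hc⟩ := ENat.ne_top_iff_exists.mp hfin
      rw [← hc] at h ⊢
      have h' : 2 * n₀ = c + c := by exact_mod_cast h
      congr 1
      omega
    have h2w : ord (𝔓.comap ((W.divisionField 3).integralClosureToAbsIntegers (𝓞 K))) (2 * w₀) =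
        ((4 + n₀ : ℕ) : ℕ∞) := by
      rw [ord_mul _ hPF0, h2L, hordw₀, he2, ho2]
      push_cast
      ring
    have hx : ord (𝔓.comap ((W.divisionField 3).integralClosureToAbsIntegers (𝓞 K))) (w₀ - 0) = (n₀ : ℕ∞) := by
      rw [sub_zero, hordw₀]
    have hnF : ((n₀ : ℕ) : integralClosure (𝓞 K) (W.divisionField 3)) ∉
        𝔓.comap ((W.divisionField 3).integralClosureToAbsIntegers (𝓞 K)) := by
      intro hmem
      apply hn₀u
      rw [← hcomap, Ideal.mem_comap, map_natCast, h𝔓Fr, Ideal.under_def, Ideal.mem_comap, map_natCast]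
      exact hmem
    have h := (lowerIndex_eq_of_smul_eq_neg hPF0 hι1 hιw (smul_zero ι) h2w hx hnF).2
    rw [h, show 4 + n₀ - n₀ = 4 by omega]
  -- ### Conclusion: `Sw = 2 φ_E(4) = 6`
  have key := W.swanConductorAt_torsion_three_eq_two_mul_herbrandPhi_xDivisionField hv2 h3 h𝔓 hι hb
  rw [key]
  simp only [Nat.cast_ofNat]
  rw [hphi]
  norm_num

set_option maxHeartbeats 4000000 in
set_option synthInstance.maxHeartbeats 400000 in
/-- **`Sw_𝔓(E[3]) = 6` on the cyclic classes `(v(Δ), v(c₄), v(c₆)) = (9 + 6j, 5 + 2j, 8 + 3j)`** —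
every elliptic curve over `ℚ` with `c₄ = 2^{5+2j} c₄'`, `c₆ = 2^{8+3j} c₆'`, `Δ = 2^{9+6j} Δ'`,
`c₄', c₆'` odd (`j = 0`: Kodaira type `III`, `j = 1`: type `III*`, minimal; `j ≥ 2`: the same curves in
non-minimal models), and every prime `𝔓 ∣ 2` of `\bar ℤ`: the certificate of
`swanConductorAt_torsion_three_eq_six_of_cyclic_cert` with `q = 3 + 2j`, `a = 5 + 2j`,
`u₀ = c₄' - 3δ₁`, `u_k = c₄' - 3ζ^kδ₁`, `γ = 2^{3+j} c₆' ρ`, `ρ = 1` (`c₄' ≡ 1 mod 4`) or `1 + 2ζ`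
(`c₄' ≡ 3 mod 4`), using `27 δ₁³ = c₄'³ - 2c₆'²`, i.e. `u₀ (9δ₁² + 3c₄'δ₁ + c₄'²) = 2 c₆'²`, and
`δ₁ ≡ Δ' (mod 8)`.  Value `6 = f - 2` (`f = 8` for these types, Ogg–Saito).
[cite: SilvermanATAEC1994, Thm. IV.11.1 p = 2 (p. 366)] -/
theorem swanConductorAt_torsion_three_of_cyclic_class (W : WeierstrassCurve ℚ) [W.IsElliptic]
    {v : HeightOneSpectrum (𝓞 ℚ)} (hv2 : (2 : 𝓞 ℚ) ∈ v.asIdeal)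
    {𝔓 : Ideal (absIntegers (𝓞 ℚ) ℚ)} (h𝔓 : 𝔓 ∈ v.primesAbove) (j : ℕ)
    {c4' c6' D' : ℤ} (hc4 : W.c₄ = (2 : ℚ) ^ (5 + 2 * j) * c4') (hc6 : W.c₆ = (2 : ℚ) ^ (8 + 3 * j) * c6')
    (hΔ : W.Δ = (2 : ℚ) ^ (9 + 6 * j) * D') (hc4odd : Odd c4') (hc6odd : Odd c6') :
    (W.torsionGaloisRep 3).swanConductorAt (𝓞 ℚ) 𝔓 = 6 := by
  classical
  haveI : Fact (Nat.Prime 3) := ⟨Nat.prime_three⟩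
  -- (P0) the place
  have h3 : ((3 : ℕ) : 𝓞 ℚ) ∉ v.asIdeal := by
    intro h3v
    have h1 : (1 : 𝓞 ℚ) ∈ v.asIdeal := by
      have e : (1 : 𝓞 ℚ) = ((3 : ℕ) : 𝓞 ℚ) - 2 := by norm_num
      rw [e]; exact Ideal.sub_mem _ h3v hv2
    exact v.isPrime.ne_top ((Ideal.eq_top_iff_one _).mpr h1)
  have hπ2 : (2 : 𝓞 ℚ) ∉ v.asIdeal ^ 2 := by
    have := Rat.prime_notMem_asIdeal_sq v Nat.prime_two (by exact_mod_cast hv2)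
    exact_mod_cast this
  -- (P1) `27 Δ' = c₄'³ - 2 c₆'²` and the residues: `d₀ ≡ Δ' (mod 8)`, `ρ² = 1 - g²`
  have hD27 : (27 : ℤ) * D' = c4' ^ 3 - 2 * c6' ^ 2 := by
    have key : (((27 : ℤ) * D' : ℤ) : ℚ) = ((c4' ^ 3 - 2 * c6' ^ 2 : ℤ) : ℚ) := by
      have h := W.c_relation
      rw [hc4, hc6, hΔ] at h
      have h2j : (2 : ℚ) ^ j ≠ 0 := pow_ne_zero _ two_ne_zero
      have h15 : (2 : ℚ) ^ (15 + 6 * j) ≠ 0 := pow_ne_zero _ two_ne_zero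
      push_cast
      apply mul_left_cancel₀ h15
      linear_combination h
    exact_mod_cast key
  obtain ⟨k, r, hk, hr⟩ : ∃ k r : ℤ, c4' = 8 * k + r ∧ (r = 1 ∨ r = 3 ∨ r = 5 ∨ r = 7) := by
    have := Int.odd_iff.mp hc4odd
    exact ⟨c4' / 8, c4' % 8, by omega, by omega⟩
  obtain ⟨t, ht⟩ : ∃ t : ℤ, c6' = 2 * t + 1 := ⟨c6' / 2, by have := Int.odd_iff.mp hc6odd; omega⟩
  obtain ⟨K3, hK3⟩ : ∃ K3 : ℤ, c4' ^ 3 = 8 * K3 + r ^ 3 := ⟨64 * k ^ 3 + 24 * k ^ 2 * r + 3 * k * r ^ 2, by rw [hk]; ring⟩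
  obtain ⟨K2, hK2⟩ : ∃ K2 : ℤ, c4' ^ 2 = 8 * K2 + r ^ 2 := ⟨8 * k ^ 2 + 2 * k * r, by rw [hk]; ring⟩
  have hT2ex : ∃ T2 : ℤ, c6' ^ 2 = 8 * T2 + 1 := by
    obtain ⟨m, hm⟩ : ∃ m : ℤ, t ^ 2 + t = 2 * m := by
      obtain ⟨m, hm⟩ := Int.even_mul_succ_self t
      exact ⟨m, by rw [← two_mul] at hm; rw [← hm]; ring⟩
    exact ⟨m, by rw [ht]; linear_combination 4 * hm⟩
  obtain ⟨T2, hT2⟩ := hT2ex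
  obtain ⟨d₀, g, mI, mQ, hd₀odd, hg, hmI, hmQ⟩ : ∃ d₀ g mI mQ : ℤ, Odd d₀ ∧ (g = 0 ∨ g = 2) ∧
      D' - d₀ ^ 3 = 8 * mI ∧ 1 - (9 * d₀ ^ 2 + 3 * c4' * d₀ + c4' ^ 2) * (1 - g ^ 2) = 8 * mQ := by
    rcases hr with hr | hr | hr | hr <;> subst hr
    · refine ⟨5, 0, (D' - 125) / 8, (1 - (9 * 25 + 3 * c4' * 5 + c4' ^ 2)) / 8, ⟨2, by norm_num⟩, Or.inl rfl, ?_, ?_⟩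
      · norm_num at hK3 ⊢; omega
      · norm_num at hK2 ⊢; omega
    · refine ⟨3, 2, (D' - 27) / 8, (1 - (9 * 9 + 3 * c4' * 3 + c4' ^ 2) * (1 - 4)) / 8, ⟨1, by norm_num⟩, Or.inr rfl, ?_, ?_⟩
      · norm_num at hK3 ⊢; omega
      · norm_num at hK2 ⊢; omega
    · refine ⟨1, 0, (D' - 1) / 8, (1 - (9 * 1 + 3 * c4' * 1 + c4' ^ 2)) / 8, ⟨0, by norm_num⟩, Or.inl rfl, ?_, ?_⟩
      · norm_num at hK3 ⊢; omega
      · norm_num at hK2 ⊢; omega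
    · refine ⟨7, 2, (D' - 343) / 8, (1 - (9 * 49 + 3 * c4' * 7 + c4' ^ 2) * (1 - 4)) / 8, ⟨3, by norm_num⟩, Or.inr rfl, ?_, ?_⟩
      · norm_num at hK3 ⊢; omega
      · norm_num at hK2 ⊢; omega
  have hρ2 : (1 + g) ^ 2 - (1 - g ^ 2) = g * (2 + 2 * g) := by ring
  -- (P2) radicals, integral generators, `δ₁ = δ / 2^q`, `q = 3 + 2j`
  have hC4 : algebraMap (𝓞 ℚ) ℚ ((2 ^ (5 + 2 * j) * c4' : ℤ) : 𝓞 ℚ) = W.c₄ := by rw [map_intCast, hc4]; push_cast; ring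
  have hD : algebraMap (𝓞 ℚ) ℚ ((2 ^ (9 + 6 * j) * D' : ℤ) : 𝓞 ℚ) = W.Δ := by rw [map_intCast, hΔ]; push_cast; ring
  have hc4K : algebraMap ℚ (AlgebraicClosure ℚ) W.c₄ = (2 : AlgebraicClosure ℚ) ^ (5 + 2 * j) * (c4' : AlgebraicClosure ℚ) := by
    rw [hc4]; simp only [map_pow, map_mul, map_ofNat, map_intCast]
  have hc6K : algebraMap ℚ (AlgebraicClosure ℚ) W.c₆ = (2 : AlgebraicClosure ℚ) ^ (8 + 3 * j) * (c6' : AlgebraicClosure ℚ) := by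
    rw [hc6]; simp only [map_pow, map_mul, map_ofNat, map_intCast]
  have hΔK : algebraMap ℚ (AlgebraicClosure ℚ) W.Δ = (2 : AlgebraicClosure ℚ) ^ (9 + 6 * j) * (D' : AlgebraicClosure ℚ) := by
    rw [hΔ]; simp only [map_pow, map_mul, map_ofNat, map_intCast]
  have hD₁ : (2 : 𝓞 ℚ) ^ (3 * (3 + 2 * j)) * ((D' : ℤ) : 𝓞 ℚ) = ((2 ^ (9 + 6 * j) * D' : ℤ) : 𝓞 ℚ) := by
    push_cast; ring
  have hm : ((D' : ℤ) : 𝓞 ℚ) - ((d₀ : ℤ) : 𝓞 ℚ) ^ 3 = 8 * ((mI : ℤ) : 𝓞 ℚ) := by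
    have h := congrArg (Int.cast : ℤ → 𝓞 ℚ) hmI
    push_cast at h ⊢
    exact h
  obtain ⟨ζ, δ, R₀, R₁, R₂, hζ, hδ, h₀, h₁, h₂, hρ, ζE, δE, R₀E, R₁E, R₂E, δ₁, vζ, vδ, vR₀, vR₁, vR₂, vδ₁, hw⟩ :=
    W.exists_radical_generators_ord_sub_intCast hv2 h3 h𝔓 hD hC4 hD₁ hd₀odd hm
  have h2K : (2 : ℚ) ≠ 0 := two_ne_zero
  have h3K : (3 : ℚ) ≠ 0 := three_ne_zero
  have hc₆ : W.c₆ ≠ 0 := by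
    rw [hc6]
    refine mul_ne_zero (pow_ne_zero _ two_ne_zero) ?_
    have hne : c6' ≠ 0 := by
      rintro rfl
      have := Int.odd_iff.mp hc6odd
      omega
    exact_mod_cast hne
  -- (P3) instances and the prime `𝔓_E`
  haveI hDDE : IsDedekindDomain (integralClosure (𝓞 ℚ) (W.xDivisionField 3)) := integralClosure.isDedekindDomain (𝓞 ℚ) ℚ (W.xDivisionField 3)
  haveI : 𝔓.IsPrime := h𝔓.1
  haveI h𝔓max : 𝔓.IsMaximal := HeightOneSpectrum.isMaximal_of_mem_primesAbove h𝔓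
  haveI : IsGalois ℚ (W.xDivisionField 3) := {}
  haveI hPEmax : (𝔓.comap ((W.xDivisionField 3).integralClosureToAbsIntegers (𝓞 ℚ))).IsMaximal := isMaximal_comap_integralClosureToAbsIntegers (𝓞 ℚ) 𝔓 (W.xDivisionField 3)
  have hunderE : (𝔓.comap ((W.xDivisionField 3).integralClosureToAbsIntegers (𝓞 ℚ))).under (𝓞 ℚ) = v.asIdeal := by
    rw [under_comap_integralClosureToAbsIntegers, ← h𝔓.2.over]
  have h2E : (2 : integralClosure (𝓞 ℚ) (W.xDivisionField 3)) ∈ (𝔓.comap ((W.xDivisionField 3).integralClosureToAbsIntegers (𝓞 ℚ))) := by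
    have : (2 : 𝓞 ℚ) ∈ (𝔓.comap ((W.xDivisionField 3).integralClosureToAbsIntegers (𝓞 ℚ))).under (𝓞 ℚ) := by rw [hunderE]; exact hv2
    rw [Ideal.under_def, Ideal.mem_comap, map_ofNat] at this
    exact this
  have hPE0 : (𝔓.comap ((W.xDivisionField 3).integralClosureToAbsIntegers (𝓞 ℚ))) ≠ ⊥ := by
    intro h0; rw [h0] at h2E
    exact two_ne_zero ((Ideal.mem_bot).mp h2E)
  have hPE1 : (𝔓.comap ((W.xDivisionField 3).integralClosureToAbsIntegers (𝓞 ℚ))) ≠ ⊤ := hPEmax.ne_top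
  have h3E : (3 : integralClosure (𝓞 ℚ) (W.xDivisionField 3)) ∉ (𝔓.comap ((W.xDivisionField 3).integralClosureToAbsIntegers (𝓞 ℚ))) := by
    intro hmem; apply h3
    rw [← hunderE, Ideal.under_def, Ideal.mem_comap, map_natCast]
    exact_mod_cast hmem
  have hinjE : ∀ {X Y : integralClosure (𝓞 ℚ) (W.xDivisionField 3)},
      ((X : W.xDivisionField 3) : AlgebraicClosure ℚ) = ((Y : W.xDivisionField 3) : AlgebraicClosure ℚ) → X = Y :=
    fun h => Subtype.ext (Subtype.ext h)
  have hval : ∀ z : ℤ, ((((z : integralClosure (𝓞 ℚ) (W.xDivisionField 3))) : W.xDivisionField 3) : AlgebraicClosure ℚ) = (z : AlgebraicClosure ℚ) := by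
    intro z; norm_cast
  have hS2 : ((((2 : integralClosure (𝓞 ℚ) (W.xDivisionField 3))) : W.xDivisionField 3) : AlgebraicClosure ℚ) = 2 := rfl
  have hS3 : ((((3 : integralClosure (𝓞 ℚ) (W.xDivisionField 3))) : W.xDivisionField 3) : AlgebraicClosure ℚ) = 3 := rfl
  have eζ : ζE ^ 2 + ζE + 1 = 0 := hinjE (by push_cast; rw [vζ]; exact hζ)
  obtain ⟨hζu, -⟩ := W.zeta_notMem_and_one_add_two_mul_zeta_notMem h3 h𝔓 eζ
  have h2val : (2 : AlgebraicClosure ℚ) ≠ 0 := two_ne_zero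
  -- the order `o = v(2)` and `ε = δ₁ - d₀ ∈ 𝔓_E^{3o}`
  obtain ⟨o, ho⟩ := exists_ord_eq_natCast _ hPE0 (two_ne_zero : (2 : integralClosure (𝓞 ℚ) (W.xDivisionField 3)) ≠ 0)
  have ho1 : 1 ≤ o := by
    have h1 : ((1 : ℕ) : ℕ∞) ≤ ord (𝔓.comap ((W.xDivisionField 3).integralClosureToAbsIntegers (𝓞 ℚ)))
        (2 : integralClosure (𝓞 ℚ) (W.xDivisionField 3)) := by
      rw [← mem_pow_iff_le_ord, pow_one]; exact h2E
    rw [ho] at h1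
    exact_mod_cast h1
  have h3w : ((3 * o : ℕ) : ℕ∞) ≤
      ord (𝔓.comap ((W.xDivisionField 3).integralClosureToAbsIntegers (𝓞 ℚ))) (δ₁ - ((d₀ : ℤ) : integralClosure (𝓞 ℚ) (W.xDivisionField 3))) := by
    have h := hw
    rw [ho] at h
    exact_mod_cast h
  have hεP : δ₁ - ((d₀ : ℤ) : integralClosure (𝓞 ℚ) (W.xDivisionField 3)) ∈
      𝔓.comap ((W.xDivisionField 3).integralClosureToAbsIntegers (𝓞 ℚ)) := by
    have h3le : ((1 : ℕ) : ℕ∞) ≤ ord (𝔓.comap ((W.xDivisionField 3).integralClosureToAbsIntegers (𝓞 ℚ)))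
        (δ₁ - ((d₀ : ℤ) : integralClosure (𝓞 ℚ) (W.xDivisionField 3))) :=
      le_trans (by exact_mod_cast (show 1 ≤ 3 * o by omega)) h3w
    rw [← mem_pow_iff_le_ord, pow_one] at h3le
    exact h3le
  have hδ₁u : δ₁ ∉ 𝔓.comap ((W.xDivisionField 3).integralClosureToAbsIntegers (𝓞 ℚ)) := by
    intro h
    have : ((d₀ : ℤ) : integralClosure (𝓞 ℚ) (W.xDivisionField 3)) ∈ 𝔓.comap ((W.xDivisionField 3).integralClosureToAbsIntegers (𝓞 ℚ)) := by
      have := Ideal.sub_mem _ h hεP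
      rwa [sub_sub_cancel] at this
    exact W.intCast_notMem_of_odd hv2 h𝔓 hd₀odd this
  -- (P4) the certificate elements
  set ε : integralClosure (𝓞 ℚ) (W.xDivisionField 3) := δ₁ - ((d₀ : ℤ) : integralClosure (𝓞 ℚ) (W.xDivisionField 3)) with hεdef
  set u₀ : integralClosure (𝓞 ℚ) (W.xDivisionField 3) := (c4' : ℤ) - 3 * δ₁ with hu₀def
  set u₁ : integralClosure (𝓞 ℚ) (W.xDivisionField 3) := (c4' : ℤ) - 3 * ζE * δ₁ with hu₁def
  set u₂ : integralClosure (𝓞 ℚ) (W.xDivisionField 3) := (c4' : ℤ) - 3 * ζE ^ 2 * δ₁ with hu₂def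
  set ρE : integralClosure (𝓞 ℚ) (W.xDivisionField 3) := 1 + (g : ℤ) * ζE with hρEdef
  set γ : integralClosure (𝓞 ℚ) (W.xDivisionField 3) := 2 ^ (3 + j) * (c6' : ℤ) * ρE with hγdef
  have vδ₁' : ((δ₁ : W.xDivisionField 3) : AlgebraicClosure ℚ) * 2 ^ (3 + 2 * j) = δ := by
    rw [vδ₁]; field_simp
  -- squares of the radicals
  have hR₀sq : R₀E ^ 2 = 2 ^ (5 + 2 * j) * u₀ := by
    apply hinjE; rw [hu₀def]; push_cast; simp only [hS2, hS3]
    rw [vR₀, h₀, hc4K, ← vδ₁']; ring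
  have hR₁sq : R₁E ^ 2 = 2 ^ (5 + 2 * j) * u₁ := by
    apply hinjE; rw [hu₁def]; push_cast; simp only [hS2, hS3]
    rw [vR₁, vζ, h₁, hc4K, ← vδ₁']; ring
  have hR₂sq : R₂E ^ 2 = 2 ^ (5 + 2 * j) * u₂ := by
    apply hinjE; rw [hu₂def]; push_cast; simp only [hS2, hS3]
    rw [vR₂, vζ, h₂, hc4K, ← vδ₁']; ring
  -- units / non-units
  have hevenu₀ : ∃ e₀ : ℤ, c4' - 3 * d₀ = 2 * e₀ := ⟨(c4' - 3 * d₀) / 2, by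
    have := Int.odd_iff.mp hc4odd; have := Int.odd_iff.mp hd₀odd; omega⟩
  obtain ⟨e₀, he₀⟩ := hevenu₀
  have hu₀ : u₀ ∈ 𝔓.comap ((W.xDivisionField 3).integralClosureToAbsIntegers (𝓞 ℚ)) := by
    have e : u₀ = 2 * ((e₀ : ℤ) : integralClosure (𝓞 ℚ) (W.xDivisionField 3)) + (-3) * ε := by
      rw [hu₀def, hεdef]
      have h := congrArg (Int.cast : ℤ → integralClosure (𝓞 ℚ) (W.xDivisionField 3)) he₀
      push_cast at h ⊢
      linear_combination h
    rw [e]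
    exact Ideal.add_mem _ (Ideal.mul_mem_right _ _ h2E) (Ideal.mul_mem_left _ _ hεP)
  have hu₁ : u₁ ∉ 𝔓.comap ((W.xDivisionField 3).integralClosureToAbsIntegers (𝓞 ℚ)) := by
    have e : u₁ = (((c4' : ℤ) : integralClosure (𝓞 ℚ) (W.xDivisionField 3)) + ((-3 * d₀ : ℤ) : integralClosure (𝓞 ℚ) (W.xDivisionField 3)) * ζE)
        + (-3 * ζE) * ε := by
      rw [hu₁def, hεdef]; push_cast; ring
    intro h
    rw [e] at h
    have h1 := Ideal.sub_mem _ h (Ideal.mul_mem_left _ (-3 * ζE) hεP)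
    rw [add_sub_cancel_right] at h1
    exact intCast_add_intCast_mul_notMem_of_odd (𝔓.comap ((W.xDivisionField 3).integralClosureToAbsIntegers (𝓞 ℚ))) eζ h2E hPE1 (Or.inl hc4odd) h1
  have hu₂ : u₂ ∉ 𝔓.comap ((W.xDivisionField 3).integralClosureToAbsIntegers (𝓞 ℚ)) := by
    have e : u₂ = (((c4' + 3 * d₀ : ℤ) : integralClosure (𝓞 ℚ) (W.xDivisionField 3)) + ((3 * d₀ : ℤ) : integralClosure (𝓞 ℚ) (W.xDivisionField 3)) * ζE)
        + (3 * (1 + ζE)) * ε := by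
      rw [hu₂def, hεdef]; push_cast
      linear_combination (-(3 : integralClosure (𝓞 ℚ) (W.xDivisionField 3)) * δ₁) * eζ
    intro h
    rw [e] at h
    have h1 := Ideal.sub_mem _ h (Ideal.mul_mem_left _ (3 * (1 + ζE)) hεP)
    rw [add_sub_cancel_right] at h1
    have hodd : Odd (3 * d₀) := by
      have := Int.odd_iff.mp hd₀odd; rw [Int.odd_iff]; omega
    exact intCast_add_intCast_mul_notMem_of_odd (𝔓.comap ((W.xDivisionField 3).integralClosureToAbsIntegers (𝓞 ℚ))) eζ h2E hPE1 (Or.inr hodd) h1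
  have hρu : ρE ∉ 𝔓.comap ((W.xDivisionField 3).integralClosureToAbsIntegers (𝓞 ℚ)) := by
    have e : ρE = ((1 : ℤ) : integralClosure (𝓞 ℚ) (W.xDivisionField 3)) + ((g : ℤ) : integralClosure (𝓞 ℚ) (W.xDivisionField 3)) * ζE := by
      rw [hρEdef]; push_cast; ring
    rw [e]
    exact intCast_add_intCast_mul_notMem_of_odd (𝔓.comap ((W.xDivisionField 3).integralClosureToAbsIntegers (𝓞 ℚ))) eζ h2E hPE1 (Or.inl odd_one)
  have hc6u : ((c6' : ℤ) : integralClosure (𝓞 ℚ) (W.xDivisionField 3)) ∉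
      𝔓.comap ((W.xDivisionField 3).integralClosureToAbsIntegers (𝓞 ℚ)) := W.intCast_notMem_of_odd hv2 h𝔓 hc6odd
  -- `γ` is fixed by the `σ` fixing `ζ` (and `δ`)
  have hγval : ((γ : W.xDivisionField 3) : AlgebraicClosure ℚ) = 2 ^ (3 + j) * (c6' : AlgebraicClosure ℚ) * (1 + (g : AlgebraicClosure ℚ) * ζ) := by
    rw [hγdef, hρEdef]; push_cast; simp only [hS2]; rw [vζ]
  have hγfix : ∀ σ : absoluteGaloisGroup ℚ, σ • ζ = ζ → σ • δ = δ →
      σ • ((γ : W.xDivisionField 3) : AlgebraicClosure ℚ) = ((γ : W.xDivisionField 3) : AlgebraicClosure ℚ) := by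
    intro σ hσζ _
    rw [hγval]
    have hc : (2 : AlgebraicClosure ℚ) ^ (3 + j) * (c6' : AlgebraicClosure ℚ) = algebraMap ℚ (AlgebraicClosure ℚ) (2 ^ (3 + j) * c6') := by
      simp only [map_pow, map_mul, map_ofNat, map_intCast]
    have hg' : (g : AlgebraicClosure ℚ) = algebraMap ℚ (AlgebraicClosure ℚ) g := by simp only [map_intCast]
    rw [hc, hg', smul_mul', smul_algebraMap, smul_add, smul_one, smul_mul', smul_algebraMap, hσζ]
  -- the key relation `u₀ Q = 2 c₆'²`, `Q = 9δ₁² + 3c₄'δ₁ + c₄'²`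
  set Q : integralClosure (𝓞 ℚ) (W.xDivisionField 3) := 9 * δ₁ ^ 2 + 3 * (c4' : ℤ) * δ₁ + (c4' : ℤ) ^ 2 with hQdef
  have hδ₁cube : 27 * δ₁ ^ 3 = ((c4' : ℤ) : integralClosure (𝓞 ℚ) (W.xDivisionField 3)) ^ 3 -
      2 * ((c6' : ℤ) : integralClosure (𝓞 ℚ) (W.xDivisionField 3)) ^ 2 := by
    have hS27 : ((((27 : integralClosure (𝓞 ℚ) (W.xDivisionField 3))) : W.xDivisionField 3) : AlgebraicClosure ℚ) = 27 := rfl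
    have hD27K : (27 : AlgebraicClosure ℚ) * (D' : AlgebraicClosure ℚ) =
        (c4' : AlgebraicClosure ℚ) ^ 3 - 2 * (c6' : AlgebraicClosure ℚ) ^ 2 := by
      have h := congrArg (Int.cast : ℤ → AlgebraicClosure ℚ) hD27
      push_cast at h
      exact h
    have h2p : (2 : AlgebraicClosure ℚ) ^ (3 + 2 * j) ≠ 0 := pow_ne_zero _ two_ne_zero
    apply hinjE; push_cast
    simp only [hS2, hS27]
    rw [vδ₁, div_pow, hδ, hΔK]
    field_simp
    linear_combination (2 : AlgebraicClosure ℚ) ^ (9 + 6 * j) * hD27K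
  have huQ : u₀ * Q = 2 * ((c6' : ℤ) : integralClosure (𝓞 ℚ) (W.xDivisionField 3)) ^ 2 := by
    rw [hu₀def, hQdef]; linear_combination (-1 : integralClosure (𝓞 ℚ) (W.xDivisionField 3)) * hδ₁cube
  -- `1 - Q ρ² ∈ 𝔓_E^{3 v(2)}`
  have h8 : ord (𝔓.comap ((W.xDivisionField 3).integralClosureToAbsIntegers (𝓞 ℚ)))
      (8 : integralClosure (𝓞 ℚ) (W.xDivisionField 3)) = ((3 * o : ℕ) : ℕ∞) := by
    rw [show (8 : integralClosure (𝓞 ℚ) (W.xDivisionField 3)) = 2 ^ 3 by norm_num, ord_pow _ hPE0, ho]; push_cast; ring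
  have hρsq : ρE ^ 2 = ((1 - g ^ 2 : ℤ) : integralClosure (𝓞 ℚ) (W.xDivisionField 3)) := by
    rw [hρEdef]
    rcases hg with hg0 | hg2
    · rw [hg0]; push_cast; ring
    · rw [hg2]; push_cast; linear_combination (4 : integralClosure (𝓞 ℚ) (W.xDivisionField 3)) * eζ
  have h1Q : 1 - Q * ρE ^ 2 = 8 * ((mQ : ℤ) : integralClosure (𝓞 ℚ) (W.xDivisionField 3)) +
      (-(((1 - g ^ 2 : ℤ) : integralClosure (𝓞 ℚ) (W.xDivisionField 3)) * (18 * (d₀ : ℤ) + 9 * ε + 3 * (c4' : ℤ)))) * ε := by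
    rw [hρsq, hQdef, hεdef]
    have h := congrArg (Int.cast : ℤ → integralClosure (𝓞 ℚ) (W.xDivisionField 3)) hmQ
    push_cast at h ⊢
    linear_combination h
  have h1Qord : ((3 * o : ℕ) : ℕ∞) ≤ ord (𝔓.comap ((W.xDivisionField 3).integralClosureToAbsIntegers (𝓞 ℚ))) (1 - Q * ρE ^ 2) := by
    rw [h1Q]
    refine le_trans ?_ (min_ord_le_ord_add _ _ _)
    rw [le_min_iff]
    constructor
    · rw [ord_mul _ hPE0, h8]; exact le_self_add
    · rw [ord_mul _ hPE0]
      exact le_trans h3w le_add_self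
  -- `v(2 (2γ)²) ≤ v(R₀² - γ²)`
  have hγcert : ord (𝔓.comap ((W.xDivisionField 3).integralClosureToAbsIntegers (𝓞 ℚ))) (2 * (2 * γ) ^ 2) ≤
      ord (𝔓.comap ((W.xDivisionField 3).integralClosureToAbsIntegers (𝓞 ℚ))) (R₀E ^ 2 - γ ^ 2) := by
    have hlhs : 2 * (2 * γ) ^ 2 = 2 ^ (9 + 2 * j) * (((c6' : ℤ) : integralClosure (𝓞 ℚ) (W.xDivisionField 3)) ^ 2 * ρE ^ 2) := by
      rw [hγdef]; ring
    have hrhs : R₀E ^ 2 - γ ^ 2 = 2 ^ (5 + 2 * j) * (u₀ * (1 - Q * ρE ^ 2)) := by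
      rw [hR₀sq, hγdef]
      linear_combination (2 : integralClosure (𝓞 ℚ) (W.xDivisionField 3)) ^ (5 + 2 * j) * ρE ^ 2 * huQ
    have hu₀ord : (o : ℕ∞) ≤ ord (𝔓.comap ((W.xDivisionField 3).integralClosureToAbsIntegers (𝓞 ℚ))) u₀ := by
      have e : u₀ = 2 * ((e₀ : ℤ) : integralClosure (𝓞 ℚ) (W.xDivisionField 3)) + (-3) * ε := by
        rw [hu₀def, hεdef]
        have h := congrArg (Int.cast : ℤ → integralClosure (𝓞 ℚ) (W.xDivisionField 3)) he₀
        push_cast at h ⊢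
        linear_combination h
      rw [e]
      refine le_trans ?_ (min_ord_le_ord_add _ _ _)
      rw [le_min_iff]
      constructor
      · rw [ord_mul _ hPE0, ho]; exact le_self_add
      · rw [ord_mul _ hPE0]
        refine le_trans ?_ le_add_self
        exact le_trans (by exact_mod_cast (show o ≤ 3 * o by omega)) h3w
    rw [hlhs, hrhs]
    simp only [ord_mul _ hPE0, ord_pow _ hPE0, ho, (ord_eq_zero_iff _).mpr hc6u, (ord_eq_zero_iff _).mpr hρu,
      mul_zero, add_zero]
    calc (((9 + 2 * j : ℕ)) : ℕ∞) * (o : ℕ∞) = (((5 + 2 * j : ℕ)) : ℕ∞) * (o : ℕ∞) + ((o : ℕ∞) + ((3 * o : ℕ) : ℕ∞)) := by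
          push_cast; ring
      _ ≤ (((5 + 2 * j : ℕ)) : ℕ∞) * (o : ℕ∞) + (ord (𝔓.comap ((W.xDivisionField 3).integralClosureToAbsIntegers (𝓞 ℚ))) u₀ +
            ord (𝔓.comap ((W.xDivisionField 3).integralClosureToAbsIntegers (𝓞 ℚ))) (1 - Q * ρE ^ 2)) :=
          add_le_add le_rfl (add_le_add hu₀ord h1Qord)
  -- (P5) conclude
  exact W.swanConductorAt_torsion_three_eq_six_of_cyclic_cert hv2 hπ2 h3 h𝔓 hζ hδ h₀ h₁ h₂ hρ hc₆
    vζ vR₀ vR₁ vR₂ vδ₁' hδ₁u (a := 5 + 2 * j) ⟨2 + j, by ring⟩ (by ring) hR₀sq hu₀ hR₁sq hu₁ hR₂sq hu₂ hγfix hγcert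


end WeierstrassCurve

end
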